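import Literature.NumberTheory.Sieve.HeathBrownCubicApproxU2Pairs
import Literature.NumberTheory.Sieve.HeathBrownCubicApproxU2Core
import HarnessLib

/-!
# Heath-Brown's Lemma 3.7 from Lemma 7.1, X: the `U₂^{(1)}`-bounds for `𝒜^(K)` and `ℬ^(K)`

Pure-proof file (no definitions) in the deduction of **Lemma 3.7 from the corrected Lemma 7.1** of
D. R. Heath-Brown, *Primes represented by `x³ + 2y³`*, Acta Math. 186 (2001), 1–84, §7 pp. 42–47
(decomposition of **parity.S18**, `Literature.NumberTheory.Sieve.setOf_prime_cube_add_two_mul_cube_infinite`).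
It completes the treatment of the piece `U₂^{(1)}` begun in `HeathBrownCubicApproxU2Core`
(`U2_abs_sub_le`: `|U₂^{(1)} − Û₂^{(1)}|` for a general family, bounded by sums of sifting functions
over good pairs in edge/close classes, over all good pairs (weight error), over close pairs of large
first-degree primes, and by raw family counts) by feeding these sums into the corrected Lemma 7.1
(`HeathBrown2001_lemma_7_1_normWeighted`, `normIn` form, through `sum_sifted_le_of_h7` of
`HeathBrownCubicApproxU2Pairs`) and the Mertens bookkeeping of (7.1)–(7.4):

* `classCN_window`, `U2_classCN_pattern_weight_le` — the product window
  `X^{3/2+τ} ≤ N(P₁P₂) < C_N X^{3/2+τ+2ξ}` as a floating Mertens window;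
* `U2_goodClass_sum_le`, `U2_goodAll_sum_le`, `U2_closePairs_sum_le` — the three families of ideals
  `P₁P₂` (resp. `QP`) through Lemma 7.1 at level `X^τ` on `[2, X^{2−2τ})` ("in applying Lemma 7.1, we
  have `N(P₁P₂) ≤ X^{2−2τ}`", p. 47), with pattern weights `3B_w e₁ + L_t B_w e₀ + B_f e₁`, `e₂`,
  `L_t B_c e₀` (`U2_pair_pattern_weight_le`, `sum_class_close_le`);
* `U2_weight_sub_one_le` (`(1+μ^{-1})^{N+1} − 1 ≤ 12τ³`), `log_two_div_add_one_le`, `U2_scalars_le`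
  — the scalar bookkeeping: every weight is `O(ξτ^{-3}) + O(τ²(log τ^{-1})²) = o(τ)`;
* **`U2_bound_of_h7`** — `|U₂^{(1)} − Û₂^{(1)}| ≤ RAW + C₇(600 + 400C₁ + 8 log(2C_N))·τM/log X + 225 C₇ Err log X`
  for a general family;
* `eventually_U2_params`, `rpow_tau_bounds`, `one_le_eta_mul`, `sqDefect_A_le`, `sqDefect_A_absorb`,
  `rawB_nonGood_le`, `rawB_eqNorm_le`, `rawB_degTwo_le`, `rawB_sq_le` — the raw terms: for `𝒜^(K)`
  only the square defect survives (Lemma 3.1) and `#{(x,y) : q² ∣ x³ + 2y³} ≪ ηX(ηX/q² + 1)`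
  ((7.5)–(7.6)); for `ℬ^(K)` everything through `#ℬ^(K)_R ≤ C_ℬX³/N(R)` ((7.7));
* **`U2_A_bound`**, **`U2_B_bound`** — `HeathBrown2001_lemma_7_1_normWeighted →` the `U₂^{(1)}(𝒜)`-
  and `U₂^{(1)}(ℬ)`-conjuncts of `HeathBrown2001_lemma_3_7` (same quantifier structure:
  `∀ ϖ ∈ (0,1/5) ∃ C X₀ ∀ X η …`, bound `C ξτ^{-4}·(η²X², ηX³)/log X`).

With `HeathBrownCubicApproxS4` (`S₄`), `HeathBrownCubicApproxUA`/`UB` (`U^(n)`, `U₁^(1)`, `U₁^(2)`)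
all ten conjuncts of Lemma 3.7 are now derived from the corrected Lemma 7.1; the assembly
`HeathBrown2001_lemma_3_7_of_lemma_7_1` is the next (pure-proof) file.

## References

* D. R. Heath-Brown, *Primes represented by `x³ + 2y³`*, Acta Math. 186 (2001), 1–84: Lemma 3.7
  (p. 17), §7 pp. 42–47, (7.1)–(7.7). [cite: HeathBrownActa2001, Lemma 3.7]
* G. Harman, *Prime-Detecting Sieves*, LMS Monographs 33, Princeton (2007), §13.2. [cite: Harman2007, §13.2]

## Mathlib / tree search

Mathlib: `Real.log_le_sub_one_of_pos`, `Real.sq_sqrt`, `Real.add_one_le_exp`, `Real.exp_one_lt_d9`,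
`one_add_pow` bounds (via `one_add_pow_sub_one_le` of `HeathBrownCubicHatCore`), `Finset.sum_image`,
`Finset.prod_pair`, `Finset.card_pair`. Tree: `HeathBrownCubicApproxU2Core` (`U2_abs_sub_le`),
`HeathBrownCubicApproxU2Pairs` (`sum_sifted_le_of_h7`, `U2_pair_pattern_weight_le`,
`classD2_window`, `chain1_props`, `pair_eq_of_mul_eq`), `HeathBrownCubicApproxUWeights`
(`sum_class_floating_le`, `sum_class_close_le`, `smallPrimes_normWt_le`, `image_pattern_subset`,
`sum_image_absNorm_uIdeal_le`, `pattern_max_min`, `pattern_props`, `mem_P0_iff`),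
`HeathBrownCubicChainSums` (`esymm_le_pow_div_factorial`, `sum_image_prod_normWt_le`,
`exists_sum_normWt_window_le`), `HeathBrownCubicApproxUSum` (`mu_props`), `HeathBrownCubicApproxUA`
(`E1_A_eq_zero`, `card_boxPairs_sq_dvd_le`, `eventually_hbTau_pow_mul_log`), `HeathBrownCubicApproxUB`
(`E1_B_le`), `HeathBrownCubicApproxS4` (`absorb_le3`, `hbXi_div_pow_four`, `eventually_le_hbTau_mul_log`,
`absNorm_pairIdeal_bounds`, `absNorm_normWindow_bounds`), `HeathBrownCubicUpperBoundTools`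
(`exists_countB_le`, `sum_inv_absNorm_nonprime_le`, `sum_inv_absNorm_pair_eq_le`, `sum_inv_absNorm_le`,
`sum_inv_sq_tail_le`, `sum_primes_le_three_mul_sum_image`, `eventually_upperBound_params`),
`HeathBrownCubicUpperBoundWeights` (`absorb_le`, `ten_le_log`, `rpow_two_sub`, `rpow_three_sub`).
-/

noncomputable section

open Polynomial NumberField Finset Filter Topology Asymptotics
open scoped nonZeroDivisors

namespace Literature.NumberTheory.Sieve.CubicSieve

open LFunctions.CubeRootTwoField CubicPrimes
open Literature.NumberTheory.LFunctions (idealNormCount)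

section Windows

variable {X τ CN C₁ : ℝ}

/-- **Product window with a constant.** For a good chain index of `U^(1)` with
`X^{3/2+τ} ≤ N(P₁P₂) < C_N X^{3/2+τ+2ξ}` (`C_N ≥ 1`), the larger norm lies in `(Y, Y·2C_N X^{2ξ}]`
with `Y = X^{3/2+τ}/(2p₂)`. [cite: HeathBrownActa2001, §7 p. 46] -/
theorem classCN_window (hX : 1 < X) (hCN1 : 1 ≤ CN) {t : Finset (Ideal (𝓞 K)) × Ideal (𝓞 K)}
    (ht : t ∈ Upairs X τ 1) (hg : UGood t)
    (hlow : X ^ (3 / 2 + τ) ≤ (Ideal.absNorm (uIdeal t) : ℝ))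
    (hd : (Ideal.absNorm (uIdeal t) : ℝ) < CN * X ^ (3 / 2 + τ + 2 * hbXi τ)) :
    ∃ h : ((insert t.2 t.1).image Ideal.absNorm).Nonempty,
      let σ := (insert t.2 t.1).image Ideal.absNorm
      let σ' := σ.erase (σ.max' h)
      let lo : ℝ := X ^ (3 / 2 + τ) / (2 * ∏ p ∈ σ', (p : ℝ))
      0 < lo ∧ lo < (σ.max' h : ℝ) ∧ (σ.max' h : ℝ) ≤ lo * (2 * CN * X ^ ((1 + 1) * hbXi τ)) := by
  classical
  have hX0 : 0 < X := by linarith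
  obtain ⟨hne, hprod, -, -⟩ := pattern_max_min ht hg
  obtain ⟨-, -, hprodN, -⟩ := pattern_props ht hg
  refine ⟨hne, ?_⟩
  set σ := (insert t.2 t.1).image Ideal.absNorm with hσ
  set p₁ := σ.max' hne with hp₁
  set D : ℝ := ∏ p ∈ σ.erase p₁, (p : ℝ) with hD
  have hD0 : 0 < D := by
    rw [hD]; refine prod_pos fun p hp => ?_
    obtain ⟨Q, hQ, rfl⟩ := mem_image.mp (mem_of_mem_erase hp)
    exact_mod_cast (hg.1 Q hQ).pos
  have hN : (Ideal.absNorm (uIdeal t) : ℝ) = p₁ * D := by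
    rw [← hprodN, Nat.cast_prod, hprod]
  simp only
  have hX1τ : 0 < X ^ (3 / 2 + τ) := Real.rpow_pos_of_pos hX0 _
  refine ⟨by positivity, ?_, ?_⟩
  · rw [div_lt_iff₀ (by positivity)]
    rw [hN] at hlow; nlinarith
  · have h1 : X ^ (3 / 2 + τ) / (2 * D) * (2 * CN * X ^ ((1 + 1) * hbXi τ)) =
        CN * X ^ (3 / 2 + τ + 2 * hbXi τ) / D := by
      rw [show (3 / 2 + τ + 2 * hbXi τ : ℝ) = (3 / 2 + τ) + (1 + 1) * hbXi τ by ring,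
        Real.rpow_add hX0 (3 / 2 + τ) ((1 + 1) * hbXi τ)]
      field_simp
    rw [h1, le_div_iff₀ hD0, ← hN]; exact hd.le

open scoped Classical in
/-- **Pattern weight of the product window with a constant**: the good chain indices of `U^(1)` with
`X^{3/2+τ} ≤ N(P₁P₂) < C_N X^{3/2+τ+2ξ}` have pattern weight at most
`2(2ξ log X + log(2C_N) + C₁)/(τ log X) · e₁(P0)` (floating Mertens window).
[cite: HeathBrownActa2001, §7 pp. 43, 46] -/
theorem U2_classCN_pattern_weight_le (hC₁ : 0 ≤ C₁)
    (hwin : ∀ (lo hi : ℝ) (T : Finset ℕ), 2 ≤ lo → lo ≤ hi →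
      (∀ p ∈ T, p.Prime ∧ lo < (p : ℝ) ∧ (p : ℝ) ≤ hi) →
      ∑ p ∈ T, (idealNormCount K p : ℝ) * (p : ℝ)⁻¹ ≤
        Real.log (Real.log hi / Real.log lo) + C₁ / Real.log lo)
    (hX : 1 < X) (hτ : 0 < τ) (hXτ : 4 ≤ X ^ τ) (hCN1 : 1 ≤ CN) :
    ∑ σ ∈ ((Upairs X τ 1).filter (fun t => UGood t ∧
          X ^ (3 / 2 + τ) ≤ (Ideal.absNorm (uIdeal t) : ℝ) ∧
          (Ideal.absNorm (uIdeal t) : ℝ) < CN * X ^ (3 / 2 + τ + 2 * hbXi τ))).image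
          (fun t => (insert t.2 t.1).image Ideal.absNorm),
        ∏ p ∈ σ, (idealNormCount K p : ℝ) * (p : ℝ)⁻¹ ≤
      (2 * (2 * hbXi τ * Real.log X + Real.log (2 * CN) + C₁) / (τ * Real.log X)) *
        ∑ σ' ∈ ((range (⌊X ^ (1 - τ)⌋₊ + 1)).filter
            (fun p : ℕ => p.Prime ∧ X ^ τ ≤ (p : ℝ) ∧ (p : ℝ) < X ^ (1 - τ))).powersetCard 1,
          ∏ p ∈ σ', (idealNormCount K p : ℝ) * (p : ℝ)⁻¹ := by
  classical
  have hX0 : 0 < X := by linarith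
  have hξ := hbXi_pos hτ
  set P0 := (range (⌊X ^ (1 - τ)⌋₊ + 1)).filter
    (fun p : ℕ => p.Prime ∧ X ^ τ ≤ (p : ℝ) ∧ (p : ℝ) < X ^ (1 - τ)) with hP0
  set T := (Upairs X τ 1).filter (fun t => UGood t ∧
    X ^ (3 / 2 + τ) ≤ (Ideal.absNorm (uIdeal t) : ℝ) ∧
    (Ideal.absNorm (uIdeal t) : ℝ) < CN * X ^ (3 / 2 + τ + 2 * hbXi τ)) with hT
  have hP0mem : ∀ p ∈ P0, p.Prime ∧ X ^ τ ≤ (p : ℝ) := fun p hp =>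
    ⟨(mem_P0_iff.mp hp).1, (mem_P0_iff.mp hp).2.1⟩
  have hgood : ∀ t ∈ T, t ∈ Upairs X τ 1 ∧ UGood t := fun t ht =>
    ⟨(mem_filter.mp ht).1, (mem_filter.mp ht).2.1⟩
  have hρ : (1 : ℝ) ≤ 2 * CN * X ^ ((1 + 1) * hbXi τ) := by
    have h1 : (1 : ℝ) ≤ X ^ ((1 + 1) * hbXi τ) := Real.one_le_rpow hX.le (by positivity)
    nlinarith
  have h := sum_class_floating_le P0 hC₁ hwin hX hτ hXτ hP0mem _ (image_pattern_subset (n := 1) T hgood)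
    (fun σ' => X ^ (3 / 2 + τ) / (2 * ∏ p ∈ σ', (p : ℝ))) hρ
    (fun σ hσ => by
      obtain ⟨t, ht, rfl⟩ := mem_image.mp hσ
      obtain ⟨htU, hg, hbg, hf⟩ := mem_filter.mp ht
      exact classCN_window hX hCN1 htU hg hbg hf)
  refine h.trans (le_of_eq ?_)
  rw [Real.log_mul (by positivity) (by positivity), Real.log_rpow hX0]
  ring

end Windows
section FamilySums

variable {ι : Type*} (E : Finset ι) (I : ι → Ideal (𝓞 K)) {X τ C₇ C₁ M Err CN : ℝ}

open scoped Classical in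
/-- **The good pairs of `U^(1)` in the edge/close classes (with the product window
`N(P₁P₂) < C_N X^{3/2+τ+2ξ}`) through Lemma 7.1**: with `B_w = 2(2ξ log X + log 2 + C₁)/(τ log X)`,
`B_f = 2(2ξ log X + log(2C_N) + C₁)/(τ log X)`, `L_t = ∑_{P0} w`, `e_j` the elementary symmetric
sums of `w(p) = c_K(p)/p` over `P0 = {X^τ ≤ p < X^{1−τ}}`:
`∑ S_K(𝒵_{P₁P₂}, X^τ) ≤ C₇ (M/(τ log X)) (3B_w e₁ + L_t B_w e₀ + B_f e₁) + 3 log X · C₇ Err`.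
[cite: HeathBrownActa2001, §7 pp. 43, 46–47] -/
theorem U2_goodClass_sum_le (hC₁ : 0 ≤ C₁)
    (hwin : ∀ (lo hi : ℝ) (T : Finset ℕ), 2 ≤ lo → lo ≤ hi →
      (∀ p ∈ T, p.Prime ∧ lo < (p : ℝ) ∧ (p : ℝ) ≤ hi) →
      ∑ p ∈ T, (idealNormCount K p : ℝ) * (p : ℝ)⁻¹ ≤
        Real.log (Real.log hi / Real.log lo) + C₁ / Real.log lo)
    (hX : (2 : ℝ) ^ 15 ≤ X) (hτ : 0 < τ) (hτ1 : τ ≤ 1 / 8) (hXτ : 4 ≤ X ^ τ) (hCN1 : 1 ≤ CN)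
    (hC₇ : 0 ≤ C₇) (hM : 0 ≤ M) (hErr : 0 ≤ Err)
    (h7 : ∀ (N z : ℝ) (𝒬 : Finset ℕ), X ^ τ ≤ z → 0 < N → N ≤ X ^ (2 - 2 * τ) →
        (∀ q ∈ 𝒬, Squarefree q ∧ N < q ∧ (q : ℝ) ≤ 2 * N) →
        ∑ Q ∈ normIn 𝒬, (famSifted E I Q z : ℝ) ≤
          C₇ * (M / Real.log (min z (X ^ (2 - τ) / N)) *
            ∑ Q ∈ normIn 𝒬, ((Ideal.absNorm Q : ℕ) : ℝ)⁻¹ + Err)) :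
    ∑ t ∈ (Upairs X τ 1).filter (fun t => UGood t ∧
        X ^ (3 / 2 + τ) ≤ (Ideal.absNorm (uIdeal t) : ℝ) ∧
        ((∃ Q ∈ insert t.2 t.1, (Ideal.absNorm Q : ℝ) < X ^ (τ + hbXi τ)) ∨
         (∃ Q ∈ insert t.2 t.1, X ^ (1 - τ - hbXi τ) ≤ (Ideal.absNorm Q : ℝ)) ∨
         (∃ Q ∈ insert t.2 t.1, ∃ Q' ∈ insert t.2 t.1, Ideal.absNorm Q < Ideal.absNorm Q' ∧
            (Ideal.absNorm Q' : ℝ) < Ideal.absNorm Q * X ^ hbXi τ) ∨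
         ((Ideal.absNorm (uIdeal t) : ℝ) < CN * X ^ (3 / 2 + τ + 2 * hbXi τ)))),
        (famSifted E I (uIdeal t) (X ^ τ) : ℝ) ≤
      C₇ * (M / (τ * Real.log X)) *
        (3 * (2 * (2 * hbXi τ * Real.log X + Real.log 2 + C₁) / (τ * Real.log X)) *
            ∑ σ' ∈ ((range (⌊X ^ (1 - τ)⌋₊ + 1)).filter
                (fun p : ℕ => p.Prime ∧ X ^ τ ≤ (p : ℝ) ∧ (p : ℝ) < X ^ (1 - τ))).powersetCard 1,
              ∏ p ∈ σ', (idealNormCount K p : ℝ) * (p : ℝ)⁻¹ +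
          (∑ p ∈ (range (⌊X ^ (1 - τ)⌋₊ + 1)).filter
              (fun p : ℕ => p.Prime ∧ X ^ τ ≤ (p : ℝ) ∧ (p : ℝ) < X ^ (1 - τ)),
              (idealNormCount K p : ℝ) * (p : ℝ)⁻¹) *
            (2 * (2 * hbXi τ * Real.log X + Real.log 2 + C₁) / (τ * Real.log X)) *
            ∑ σ' ∈ ((range (⌊X ^ (1 - τ)⌋₊ + 1)).filter
                (fun p : ℕ => p.Prime ∧ X ^ τ ≤ (p : ℝ) ∧ (p : ℝ) < X ^ (1 - τ))).powersetCard 0,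
              ∏ p ∈ σ', (idealNormCount K p : ℝ) * (p : ℝ)⁻¹ +
          (2 * (2 * hbXi τ * Real.log X + Real.log (2 * CN) + C₁) / (τ * Real.log X)) *
            ∑ σ' ∈ ((range (⌊X ^ (1 - τ)⌋₊ + 1)).filter
                (fun p : ℕ => p.Prime ∧ X ^ τ ≤ (p : ℝ) ∧ (p : ℝ) < X ^ (1 - τ))).powersetCard 1,
              ∏ p ∈ σ', (idealNormCount K p : ℝ) * (p : ℝ)⁻¹) +
        3 * Real.log X * (C₇ * Err) := by
  classical
  have hX1 : 1 < X := lt_of_lt_of_le (by norm_num) hX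
  have hX0 : 0 < X := by linarith
  set P0 := (range (⌊X ^ (1 - τ)⌋₊ + 1)).filter
    (fun p : ℕ => p.Prime ∧ X ^ τ ≤ (p : ℝ) ∧ (p : ℝ) < X ^ (1 - τ)) with hP0
  set w : ℕ → ℝ := fun p => (idealNormCount K p : ℝ) * (p : ℝ)⁻¹ with hw
  set pat := fun t : Finset (Ideal (𝓞 K)) × Ideal (𝓞 K) => (insert t.2 t.1).image Ideal.absNorm with hpat
  set U := Upairs X τ 1 with hU
  set big := fun t : Finset (Ideal (𝓞 K)) × Ideal (𝓞 K) =>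
    X ^ (3 / 2 + τ) ≤ (Ideal.absNorm (uIdeal t) : ℝ) with hbig
  set ca := fun t : Finset (Ideal (𝓞 K)) × Ideal (𝓞 K) =>
    ∃ Q ∈ insert t.2 t.1, (Ideal.absNorm Q : ℝ) < X ^ (τ + hbXi τ) with hca
  set cb := fun t : Finset (Ideal (𝓞 K)) × Ideal (𝓞 K) =>
    ∃ Q ∈ insert t.2 t.1, X ^ (1 - τ - hbXi τ) ≤ (Ideal.absNorm Q : ℝ) with hcb
  set ce := fun t : Finset (Ideal (𝓞 K)) × Ideal (𝓞 K) =>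
    ∃ Q ∈ insert t.2 t.1, ∃ Q' ∈ insert t.2 t.1, Ideal.absNorm Q < Ideal.absNorm Q' ∧
      (Ideal.absNorm Q' : ℝ) < Ideal.absNorm Q * X ^ hbXi τ with hce
  set cf := fun t : Finset (Ideal (𝓞 K)) × Ideal (𝓞 K) =>
    (Ideal.absNorm (uIdeal t) : ℝ) < X ^ (3 / 2 + τ + 2 * hbXi τ) with hcf
  set cg := fun t : Finset (Ideal (𝓞 K)) × Ideal (𝓞 K) =>
    (Ideal.absNorm (uIdeal t) : ℝ) < CN * X ^ (3 / 2 + τ + 2 * hbXi τ) with hcg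
  set T := U.filter (fun t => UGood t ∧ big t ∧ (ca t ∨ cb t ∨ ce t ∨ cg t)) with hT
  set T4 := U.filter (fun t => UGood t ∧ big t ∧ (ca t ∨ cb t ∨ ce t ∨ cf t)) with hT4
  set Tg := U.filter (fun t => UGood t ∧ big t ∧ cg t) with hTg
  change ∑ t ∈ T, (famSifted E I (uIdeal t) (X ^ τ) : ℝ) ≤ _
  have hTmem : ∀ t ∈ T, t ∈ Upairs X τ 1 ∧ UGood t ∧ big t ∧ (ca t ∨ cb t ∨ ce t ∨ cg t) := fun t ht =>
    ⟨(mem_filter.mp ht).1, (mem_filter.mp ht).2.1, (mem_filter.mp ht).2.2.1, (mem_filter.mp ht).2.2.2⟩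
  -- re-index by the ideal and apply Lemma 7.1 on `[2, X^{2-2τ})`
  have hinj : Set.InjOn uIdeal (T : Set _) := (uIdeal_injOn X τ 1).mono fun t ht => (hTmem t ht).1
  rw [← sum_image (f := fun Q => (famSifted E I Q (X ^ τ) : ℝ)) hinj]
  have hTimg : ∀ Q ∈ T.image uIdeal, Squarefree (Ideal.absNorm Q) ∧ (2 : ℝ) ≤ (Ideal.absNorm Q : ℝ) ∧
      (Ideal.absNorm Q : ℝ) < X ^ (2 - 2 * τ) := by
    intro Q hQ
    obtain ⟨t, ht, rfl⟩ := mem_image.mp hQ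
    obtain ⟨htU, hg, hbg, -⟩ := hTmem t ht
    obtain ⟨P₁, -, hsm1, hsm2, -, -, -, -, hu⟩ := chain1_props htU hg
    refine ⟨squarefree_absNorm_uIdeal (snd_notMem_fst htU) hg, ?_, ?_⟩
    · have : (2 : ℝ) ≤ X ^ (3 / 2 + τ) := by
        have h1 : X ^ τ ≤ X ^ (3 / 2 + τ) := Real.rpow_le_rpow_of_exponent_le hX1.le (by linarith)
        linarith
      exact this.trans hbg
    · rw [hu, map_mul, Nat.cast_mul]
      have h1 := (mem_smallPrimes_iff.mp hsm1).2.2.2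
      have h2 := (mem_smallPrimes_iff.mp hsm2).2.2.2
      calc (Ideal.absNorm P₁ : ℝ) * Ideal.absNorm t.2 < X ^ (1 - τ) * X ^ (1 - τ) :=
            mul_lt_mul'' h1 h2 (Nat.cast_nonneg _) (Nat.cast_nonneg _)
        _ = X ^ (2 - 2 * τ) := by rw [← Real.rpow_add hX0]; ring_nf
  have step2 := sum_sifted_le_of_h7 E I hX hτ hτ1 hC₇ hM hErr h7 (T.image uIdeal) hTimg
  refine step2.trans (add_le_add (mul_le_mul_of_nonneg_left ?_
    (mul_nonneg hC₇ (div_nonneg hM (mul_nonneg hτ.le (Real.log_nonneg hX1.le))))) le_rfl)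
  -- weights through patterns, then split `T ⊆ T4 ∪ Tg`
  have hTg' : ∀ t ∈ T, t ∈ Upairs X τ 1 ∧ UGood t := fun t ht => ⟨(hTmem t ht).1, (hTmem t ht).2.1⟩
  have step3 : ∑ q ∈ (T.image uIdeal).image Ideal.absNorm, w q ≤ ∑ σ ∈ T.image pat, ∏ p ∈ σ, w p := by
    rw [image_image]
    exact sum_image_absNorm_uIdeal_le T hTg'
  refine step3.trans ?_
  have hcover : T.image pat ⊆ T4.image pat ∪ Tg.image pat := by
    intro σ hσ
    obtain ⟨t, ht, rfl⟩ := mem_image.mp hσ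
    obtain ⟨htU, hg, hb, hcls⟩ := hTmem t ht
    rw [mem_union]
    rcases hcls with h | h | h | h
    · exact Or.inl (mem_image_of_mem _ (mem_filter.mpr ⟨htU, hg, hb, Or.inl h⟩))
    · exact Or.inl (mem_image_of_mem _ (mem_filter.mpr ⟨htU, hg, hb, Or.inr (Or.inl h)⟩))
    · exact Or.inl (mem_image_of_mem _ (mem_filter.mpr ⟨htU, hg, hb, Or.inr (Or.inr (Or.inl h))⟩))
    · exact Or.inr (mem_image_of_mem _ (mem_filter.mpr ⟨htU, hg, hb, h⟩))
  have hf0 : ∀ σ : Finset ℕ, 0 ≤ ∏ p ∈ σ, w p := fun σ => prod_nonneg fun p _ => normWt_nonneg p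
  have h4 := U2_pair_pattern_weight_le hC₁ hwin hX1 hτ hXτ (X := X)
  have hg' := U2_classCN_pattern_weight_le hC₁ hwin hX1 hτ hXτ hCN1 (X := X)
  calc ∑ σ ∈ T.image pat, ∏ p ∈ σ, w p
      ≤ ∑ σ ∈ T4.image pat ∪ Tg.image pat, ∏ p ∈ σ, w p :=
        sum_le_sum_of_subset_of_nonneg hcover fun σ _ _ => hf0 σ
    _ ≤ ∑ σ ∈ T4.image pat, ∏ p ∈ σ, w p + ∑ σ ∈ Tg.image pat, ∏ p ∈ σ, w p :=
        sum_union_le_add _ _ hf0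
    _ ≤ _ := by
        have e : ∀ a b c : ℝ, a + b + c = (a + b) + c := fun a b c => by ring
        rw [e]
        exact add_le_add h4 hg'

open scoped Classical in
/-- **All good pairs of `U^(1)` through Lemma 7.1** (for the weight error):
`∑_{good} S_K(𝒵_{P₁P₂}, X^τ) ≤ C₇ (M/(τ log X)) e₂(P0) + 3 log X · C₇ Err`.
[cite: HeathBrownActa2001, §7 pp. 44, 47] -/
theorem U2_goodAll_sum_le (hX : (2 : ℝ) ^ 15 ≤ X) (hτ : 0 < τ) (hτ1 : τ ≤ 1 / 8)
    (hC₇ : 0 ≤ C₇) (hM : 0 ≤ M) (hErr : 0 ≤ Err)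
    (h7 : ∀ (N z : ℝ) (𝒬 : Finset ℕ), X ^ τ ≤ z → 0 < N → N ≤ X ^ (2 - 2 * τ) →
        (∀ q ∈ 𝒬, Squarefree q ∧ N < q ∧ (q : ℝ) ≤ 2 * N) →
        ∑ Q ∈ normIn 𝒬, (famSifted E I Q z : ℝ) ≤
          C₇ * (M / Real.log (min z (X ^ (2 - τ) / N)) *
            ∑ Q ∈ normIn 𝒬, ((Ideal.absNorm Q : ℕ) : ℝ)⁻¹ + Err)) :
    ∑ t ∈ (Upairs X τ 1).filter (fun t => UGood t), (famSifted E I (uIdeal t) (X ^ τ) : ℝ) ≤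
      C₇ * (M / (τ * Real.log X)) *
        ∑ σ' ∈ ((range (⌊X ^ (1 - τ)⌋₊ + 1)).filter
            (fun p : ℕ => p.Prime ∧ X ^ τ ≤ (p : ℝ) ∧ (p : ℝ) < X ^ (1 - τ))).powersetCard 2,
          ∏ p ∈ σ', (idealNormCount K p : ℝ) * (p : ℝ)⁻¹ +
        3 * Real.log X * (C₇ * Err) := by
  classical
  have hX1 : 1 < X := lt_of_lt_of_le (by norm_num) hX
  have hX0 : 0 < X := by linarith
  set P0 := (range (⌊X ^ (1 - τ)⌋₊ + 1)).filter
    (fun p : ℕ => p.Prime ∧ X ^ τ ≤ (p : ℝ) ∧ (p : ℝ) < X ^ (1 - τ)) with hP0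
  set w : ℕ → ℝ := fun p => (idealNormCount K p : ℝ) * (p : ℝ)⁻¹ with hw
  set pat := fun t : Finset (Ideal (𝓞 K)) × Ideal (𝓞 K) => (insert t.2 t.1).image Ideal.absNorm with hpat
  set T := (Upairs X τ 1).filter (fun t => UGood t) with hT
  have hTmem : ∀ t ∈ T, t ∈ Upairs X τ 1 ∧ UGood t := fun t ht => ⟨(mem_filter.mp ht).1, (mem_filter.mp ht).2⟩
  have hinj : Set.InjOn uIdeal (T : Set _) := (uIdeal_injOn X τ 1).mono fun t ht => (hTmem t ht).1
  rw [← sum_image (f := fun Q => (famSifted E I Q (X ^ τ) : ℝ)) hinj]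
  have hTimg : ∀ Q ∈ T.image uIdeal, Squarefree (Ideal.absNorm Q) ∧ (2 : ℝ) ≤ (Ideal.absNorm Q : ℝ) ∧
      (Ideal.absNorm Q : ℝ) < X ^ (2 - 2 * τ) := by
    intro Q hQ
    obtain ⟨t, ht, rfl⟩ := mem_image.mp hQ
    obtain ⟨htU, hg⟩ := hTmem t ht
    obtain ⟨P₁, -, hsm1, hsm2, -, -, -, -, hu⟩ := chain1_props htU hg
    have hlow : X ^ (1 + τ) ≤ (Ideal.absNorm (uIdeal t) : ℝ) := by
      rw [absNorm_uIdeal]; exact_mod_cast (mem_Upairs_iff.mp htU).2.2.2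
    refine ⟨squarefree_absNorm_uIdeal (snd_notMem_fst htU) hg, ?_, ?_⟩
    · have : (2 : ℝ) ≤ X ^ (1 + τ) := by
        have h1 : X ^ (1 : ℝ) ≤ X ^ (1 + τ) := Real.rpow_le_rpow_of_exponent_le hX1.le (by linarith)
        rw [Real.rpow_one] at h1; linarith
      exact this.trans hlow
    · rw [hu, map_mul, Nat.cast_mul]
      have h1 := (mem_smallPrimes_iff.mp hsm1).2.2.2
      have h2 := (mem_smallPrimes_iff.mp hsm2).2.2.2
      calc (Ideal.absNorm P₁ : ℝ) * Ideal.absNorm t.2 < X ^ (1 - τ) * X ^ (1 - τ) :=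
            mul_lt_mul'' h1 h2 (Nat.cast_nonneg _) (Nat.cast_nonneg _)
        _ = X ^ (2 - 2 * τ) := by rw [← Real.rpow_add hX0]; ring_nf
  have step2 := sum_sifted_le_of_h7 E I hX hτ hτ1 hC₇ hM hErr h7 (T.image uIdeal) hTimg
  refine step2.trans (add_le_add (mul_le_mul_of_nonneg_left ?_
    (mul_nonneg hC₇ (div_nonneg hM (mul_nonneg hτ.le (Real.log_nonneg hX1.le))))) le_rfl)
  have step3 : ∑ q ∈ (T.image uIdeal).image Ideal.absNorm, w q ≤ ∑ σ ∈ T.image pat, ∏ p ∈ σ, w p := by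
    rw [image_image]
    exact sum_image_absNorm_uIdeal_le T hTmem
  refine step3.trans ?_
  exact sum_le_sum_of_subset_of_nonneg (image_pattern_subset (n := 1) T hTmem)
    fun σ _ _ => prod_nonneg fun p _ => normWt_nonneg p

open scoped Classical in
/-- **The close pairs of large first-degree primes through Lemma 7.1**: over the pairs `(Q, P)` of
first-degree primes with `X^{1/2} ≤ N(Q) < N(P) < N(Q)X^ξ`, `N(P) < X^{1−τ}`,
`∑ S_K(𝒵_{QP}, X^{1/2}) ≤ C₇ (M/(τ log X)) · L_t · 2(ξ log X + C₁)/(τ log X) · e₀ + 3 log X · C₇ Err`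
(the ideals `QP` are distinct, of square-free norm in `[X, X^{2−2τ})`; their patterns are close pairs
in `P0`). [cite: HeathBrownActa2001, §7 pp. 43, 47] -/
theorem U2_closePairs_sum_le (hC₁ : 0 ≤ C₁)
    (hwin : ∀ (lo hi : ℝ) (T : Finset ℕ), 2 ≤ lo → lo ≤ hi →
      (∀ p ∈ T, p.Prime ∧ lo < (p : ℝ) ∧ (p : ℝ) ≤ hi) →
      ∑ p ∈ T, (idealNormCount K p : ℝ) * (p : ℝ)⁻¹ ≤
        Real.log (Real.log hi / Real.log lo) + C₁ / Real.log lo)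
    (hX : (2 : ℝ) ^ 15 ≤ X) (hτ : 0 < τ) (hτ1 : τ ≤ 1 / 8) (hXτ : 4 ≤ X ^ τ)
    (hC₇ : 0 ≤ C₇) (hM : 0 ≤ M) (hErr : 0 ≤ Err)
    (h7 : ∀ (N z : ℝ) (𝒬 : Finset ℕ), X ^ τ ≤ z → 0 < N → N ≤ X ^ (2 - 2 * τ) →
        (∀ q ∈ 𝒬, Squarefree q ∧ N < q ∧ (q : ℝ) ≤ 2 * N) →
        ∑ Q ∈ normIn 𝒬, (famSifted E I Q z : ℝ) ≤
          C₇ * (M / Real.log (min z (X ^ (2 - τ) / N)) *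
            ∑ Q ∈ normIn 𝒬, ((Ideal.absNorm Q : ℕ) : ℝ)⁻¹ + Err)) :
    ∑ x ∈ (primesNormIco (X ^ (1 / 2 : ℝ)) (X ^ (1 - τ)) ×ˢ
        primesNormIco (X ^ (1 / 2 : ℝ)) (X ^ (1 - τ))).filter
        (fun x => (Ideal.absNorm x.1).Prime ∧ (Ideal.absNorm x.2).Prime ∧
          Ideal.absNorm x.1 < Ideal.absNorm x.2 ∧
          (Ideal.absNorm x.2 : ℝ) < Ideal.absNorm x.1 * X ^ hbXi τ),
        (famSifted E I (x.1 * x.2) (X ^ (1 / 2 : ℝ)) : ℝ) ≤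
      C₇ * (M / (τ * Real.log X)) *
        ((∑ p ∈ (range (⌊X ^ (1 - τ)⌋₊ + 1)).filter
            (fun p : ℕ => p.Prime ∧ X ^ τ ≤ (p : ℝ) ∧ (p : ℝ) < X ^ (1 - τ)),
            (idealNormCount K p : ℝ) * (p : ℝ)⁻¹) *
          (2 * (hbXi τ * Real.log X + C₁) / (τ * Real.log X)) *
          ∑ σ' ∈ ((range (⌊X ^ (1 - τ)⌋₊ + 1)).filter
              (fun p : ℕ => p.Prime ∧ X ^ τ ≤ (p : ℝ) ∧ (p : ℝ) < X ^ (1 - τ))).powersetCard 0,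
            ∏ p ∈ σ', (idealNormCount K p : ℝ) * (p : ℝ)⁻¹) +
        3 * Real.log X * (C₇ * Err) := by
  classical
  have hX1 : 1 < X := lt_of_lt_of_le (by norm_num) hX
  have hX0 : 0 < X := by linarith
  have hξ := hbXi_pos hτ
  set P0 := (range (⌊X ^ (1 - τ)⌋₊ + 1)).filter
    (fun p : ℕ => p.Prime ∧ X ^ τ ≤ (p : ℝ) ∧ (p : ℝ) < X ^ (1 - τ)) with hP0
  set w : ℕ → ℝ := fun p => (idealNormCount K p : ℝ) * (p : ℝ)⁻¹ with hw
  set T := (primesNormIco (X ^ (1 / 2 : ℝ)) (X ^ (1 - τ)) ×ˢ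
      primesNormIco (X ^ (1 / 2 : ℝ)) (X ^ (1 - τ))).filter
      (fun x => (Ideal.absNorm x.1).Prime ∧ (Ideal.absNorm x.2).Prime ∧
        Ideal.absNorm x.1 < Ideal.absNorm x.2 ∧
        (Ideal.absNorm x.2 : ℝ) < Ideal.absNorm x.1 * X ^ hbXi τ) with hT
  set mulf : Ideal (𝓞 K) × Ideal (𝓞 K) → Ideal (𝓞 K) := fun x => x.1 * x.2 with hmulf
  set pat : Ideal (𝓞 K) × Ideal (𝓞 K) → Finset ℕ := fun x =>
    ({Ideal.absNorm x.1, Ideal.absNorm x.2} : Finset ℕ) with hpat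
  have hTmem : ∀ x ∈ T, x.1.IsPrime ∧ x.1 ≠ ⊥ ∧ x.2.IsPrime ∧ x.2 ≠ ⊥ ∧ (Ideal.absNorm x.1).Prime ∧
      (Ideal.absNorm x.2).Prime ∧ Ideal.absNorm x.1 < Ideal.absNorm x.2 ∧
      X ^ (1 / 2 : ℝ) ≤ (Ideal.absNorm x.1 : ℝ) ∧ (Ideal.absNorm x.2 : ℝ) < X ^ (1 - τ) ∧
      (Ideal.absNorm x.2 : ℝ) < Ideal.absNorm x.1 * X ^ hbXi τ ∧
      X ^ (1 / 2 : ℝ) ≤ (Ideal.absNorm x.2 : ℝ) ∧ (Ideal.absNorm x.1 : ℝ) < X ^ (1 - τ) := by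
    intro x hx
    rw [hT, mem_filter, mem_product, mem_primesNormIco_iff, mem_primesNormIco_iff] at hx
    obtain ⟨⟨⟨h1, h10, h1lo, h1hi⟩, ⟨h2, h20, h2lo, h2hi⟩⟩, hp1, hp2, hlt, hclose⟩ := hx
    exact ⟨h1, h10, h2, h20, hp1, hp2, hlt, h1lo, h2hi, hclose, h2lo, h1hi⟩
  have hXτhalf : X ^ τ ≤ X ^ (1 / 2 : ℝ) := Real.rpow_le_rpow_of_exponent_le hX1.le (by linarith)
  -- lower the level to `X^τ`
  have hstep0 : ∑ x ∈ T, (famSifted E I (x.1 * x.2) (X ^ (1 / 2 : ℝ)) : ℝ) ≤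
      ∑ x ∈ T, (famSifted E I (mulf x) (X ^ τ) : ℝ) :=
    sum_le_sum fun x _ => by exact_mod_cast famSifted_antitone E I hXτhalf
  refine hstep0.trans ?_
  -- re-index by the ideal `QP`
  have hinj : Set.InjOn mulf (T : Set _) := by
    intro x hx y hy h
    obtain ⟨h1, h10, h2, h20, -, -, hlt, -⟩ := hTmem x hx
    obtain ⟨h1', h10', h2', h20', -, -, hlt', -⟩ := hTmem y hy
    have h' : x.2 * x.1 = y.2 * y.1 := by simp only [hmulf] at h; rw [mul_comm, h, mul_comm]
    obtain ⟨e2, e1⟩ := pair_eq_of_mul_eq h2 h20 h1 h10 h2' h20' h1' h10' hlt hlt' h'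
    exact Prod.ext e1 e2
  rw [← sum_image (f := fun Q => (famSifted E I Q (X ^ τ) : ℝ)) hinj]
  have hTimg : ∀ Q ∈ T.image mulf, Squarefree (Ideal.absNorm Q) ∧ (2 : ℝ) ≤ (Ideal.absNorm Q : ℝ) ∧
      (Ideal.absNorm Q : ℝ) < X ^ (2 - 2 * τ) := by
    intro Q hQ
    obtain ⟨x, hx, rfl⟩ := mem_image.mp hQ
    obtain ⟨-, -, -, -, hp1, hp2, hlt, h1lo, h2hi, -, h2lo, h1hi⟩ := hTmem x hx
    simp only [hmulf]
    rw [map_mul]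
    refine ⟨?_, ?_, ?_⟩
    · rw [Nat.squarefree_mul ((Nat.coprime_primes hp1 hp2).mpr hlt.ne)]
      exact ⟨hp1.prime.squarefree, hp2.prime.squarefree⟩
    · push_cast
      have h1' : (2 : ℝ) ≤ Ideal.absNorm x.1 := by exact_mod_cast hp1.two_le
      have h2' : (1 : ℝ) ≤ Ideal.absNorm x.2 := by exact_mod_cast hp2.one_lt.le
      nlinarith
    · push_cast
      calc (Ideal.absNorm x.1 : ℝ) * Ideal.absNorm x.2 < X ^ (1 - τ) * X ^ (1 - τ) :=
            mul_lt_mul'' h1hi h2hi (Nat.cast_nonneg _) (Nat.cast_nonneg _)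
        _ = X ^ (2 - 2 * τ) := by rw [← Real.rpow_add hX0]; ring_nf
  have step2 := sum_sifted_le_of_h7 E I hX hτ hτ1 hC₇ hM hErr h7 (T.image mulf) hTimg
  refine step2.trans (add_le_add (mul_le_mul_of_nonneg_left ?_
    (mul_nonneg hC₇ (div_nonneg hM (mul_nonneg hτ.le (Real.log_nonneg hX1.le))))) le_rfl)
  -- weights through patterns
  have hne : ∀ x ∈ T, Ideal.absNorm x.1 ≠ Ideal.absNorm x.2 := fun x hx => (hTmem x hx).2.2.2.2.2.2.1.ne
  have heq : (T.image mulf).image Ideal.absNorm = (T.image pat).image (fun σ => ∏ p ∈ σ, p) := by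
    rw [image_image, image_image]
    refine image_congr fun x hx => ?_
    simp only [Function.comp_apply, hmulf, hpat]
    rw [map_mul, prod_pair (hne x hx)]
  rw [heq]
  have step3 := sum_image_prod_normWt_le (T.image pat) (fun σ hσ p hp => by
    obtain ⟨x, hx, rfl⟩ := mem_image.mp hσ
    simp only [hpat, mem_insert, mem_singleton] at hp
    rcases hp with rfl | rfl
    · exact (hTmem x hx).2.2.2.2.1
    · exact (hTmem x hx).2.2.2.2.2.1)
  refine step3.trans ?_
  have hP0mem : ∀ p ∈ P0, p.Prime ∧ X ^ τ ≤ (p : ℝ) := fun p hp =>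
    ⟨(mem_P0_iff.mp hp).1, (mem_P0_iff.mp hp).2.1⟩
  have hsub : T.image pat ⊆ P0.powersetCard (0 + 2) := by
    intro σ hσ
    obtain ⟨x, hx, rfl⟩ := mem_image.mp hσ
    obtain ⟨-, -, -, -, hp1, hp2, hlt, h1lo, h2hi, -, h2lo, h1hi⟩ := hTmem x hx
    rw [mem_powersetCard]
    refine ⟨fun p hp => ?_, by rw [card_pair (hne x hx)]⟩
    simp only [hpat, mem_insert, mem_singleton] at hp
    rcases hp with rfl | rfl
    · exact mem_P0_iff.mpr ⟨hp1, hXτhalf.trans h1lo, h1hi⟩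
    · exact mem_P0_iff.mpr ⟨hp2, hXτhalf.trans h2lo, h2hi⟩
  have hρ : (1 : ℝ) ≤ X ^ hbXi τ := Real.one_le_rpow hX1.le hξ.le
  have h := sum_class_close_le P0 hC₁ hwin hX1 hτ hXτ hP0mem _ hsub hρ (fun σ hσ => by
    obtain ⟨x, hx, rfl⟩ := mem_image.mp hσ
    obtain ⟨-, -, -, -, -, -, hlt, -, -, hclose, -⟩ := hTmem x hx
    exact ⟨Ideal.absNorm x.1, by simp [hpat], Ideal.absNorm x.2, by simp [hpat], hlt, hclose.le⟩)
  refine h.trans (le_of_eq ?_)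
  rw [Real.log_rpow hX0]

end FamilySums
section Scalars

/-- **The weight error of `Û₂^{(1)}`**: with `μ = ⌊τξ^{-1}⌋` and `N = ⌊3/(2τ)⌋`,
`(1 + μ^{-1})^{N+1} − 1 ≤ 12τ³ ≤ 1` for `0 < τ ≤ 1/40` ("`1 ≤ d_S ≤ 1 + O(ξτ^{-2})`", p. 44, with
`n ≪ τ^{-1}`, p. 17). [cite: HeathBrownActa2001, §7 p. 44] -/
theorem U2_weight_sub_one_le {τ : ℝ} (hτ : 0 < τ) (hτ1 : τ ≤ 1 / 40) :
    (1 + 1 / ((⌊τ / hbXi τ⌋₊ : ℕ) : ℝ)) ^ (u2Bound τ + 1) - 1 ≤ 12 * τ ^ 3 ∧ 12 * τ ^ 3 ≤ 1 := by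
  obtain ⟨h1, -, hinv⟩ := mu_props hτ (by linarith)
  set x : ℝ := 1 / ((⌊τ / hbXi τ⌋₊ : ℕ) : ℝ) with hx
  have hx0 : 0 ≤ x := by rw [hx]; positivity
  have hτ3 : τ ^ 3 ≤ τ := by
    have := pow_le_of_le_one hτ.le (by linarith) (by norm_num : (3 : ℕ) ≠ 0); exact this
  have h12 : 12 * τ ^ 3 ≤ 1 := by nlinarith
  have hk : ((u2Bound τ + 1 : ℕ) : ℝ) ≤ 2 / τ := by
    have hfl : ((⌊3 / (2 * τ)⌋₊ : ℕ) : ℝ) ≤ 3 / (2 * τ) := Nat.floor_le (by positivity)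
    have hone : (1 : ℝ) ≤ 1 / (2 * τ) := by rw [le_div_iff₀ (by positivity)]; linarith
    have e : 3 / (2 * τ) + 1 / (2 * τ) = 2 / τ := by field_simp; ring
    rw [u2Bound]; push_cast; linarith
  have hkx : ((u2Bound τ + 1 : ℕ) : ℝ) * x ≤ 4 * τ ^ 3 := by
    calc ((u2Bound τ + 1 : ℕ) : ℝ) * x ≤ (2 / τ) * (2 * τ ^ 4) := mul_le_mul hk hinv hx0 (by positivity)
      _ = 4 * τ ^ 3 := by field_simp; ring
  have hkx1 : ((u2Bound τ + 1 : ℕ) : ℝ) * x ≤ 1 := by linarith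
  have hpow : (1 + x) ^ (u2Bound τ + 1) ≤ 3 := by
    calc (1 + x) ^ (u2Bound τ + 1) ≤ Real.exp x ^ (u2Bound τ + 1) :=
          pow_le_pow_left₀ (by linarith) (by have := Real.add_one_le_exp x; linarith) _
      _ = Real.exp (((u2Bound τ + 1 : ℕ) : ℝ) * x) := by rw [← Real.exp_nat_mul]
      _ ≤ Real.exp 1 := Real.exp_le_exp.mpr hkx1
      _ ≤ 3 := by have := Real.exp_one_lt_d9; linarith
  have hmain := one_add_pow_sub_one_le hx0 (u2Bound τ + 1)
  refine ⟨hmain.trans ?_, h12⟩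
  calc ((u2Bound τ + 1 : ℕ) : ℝ) * x * (1 + x) ^ (u2Bound τ + 1) ≤ 4 * τ ^ 3 * 3 :=
        mul_le_mul hkx hpow (by positivity) (by positivity)
    _ = 12 * τ ^ 3 := by ring

/-- `log(2/τ) + 1 ≤ 2/τ` and `(log(2/τ) + 1)² ≤ 8/τ` for `0 < τ ≤ 1` (`log u ≤ u − 1` at `u = 2/τ`
and at `u = √(2/τ)`). [folklore] -/
theorem log_two_div_add_one_le {τ : ℝ} (hτ : 0 < τ) (hτ1 : τ ≤ 1) :
    0 ≤ Real.log (2 / τ) + 1 ∧ Real.log (2 / τ) + 1 ≤ 2 / τ ∧ (Real.log (2 / τ) + 1) ^ 2 ≤ 8 / τ := by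
  have h2τ : (2 : ℝ) ≤ 2 / τ := by rw [le_div_iff₀ hτ]; linarith
  have hlog0 : 0 ≤ Real.log (2 / τ) := Real.log_nonneg (by linarith)
  have hA : Real.log (2 / τ) + 1 ≤ 2 / τ := by
    have := Real.log_le_sub_one_of_pos (show (0 : ℝ) < 2 / τ by positivity); linarith
  refine ⟨by linarith, hA, ?_⟩
  set u := Real.sqrt (2 / τ) with hu
  have hu2 : u ^ 2 = 2 / τ := Real.sq_sqrt (by positivity)
  have hu0 : 0 < u := Real.sqrt_pos.mpr (by positivity)
  have hlog : Real.log (2 / τ) = 2 * Real.log u := by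
    rw [← hu2, Real.log_pow]; push_cast; ring
  have hlu : Real.log u ≤ u - 1 := Real.log_le_sub_one_of_pos hu0
  have hB : Real.log (2 / τ) + 1 ≤ 2 * u := by rw [hlog]; linarith
  calc (Real.log (2 / τ) + 1) ^ 2 ≤ (2 * u) ^ 2 := pow_le_pow_left₀ (by linarith) hB 2
    _ = 8 / τ := by rw [mul_pow, hu2]; ring

/-- **Scalar bookkeeping for `U₂^{(1)}`**: with `ξ = τ⁵`, `(log X)^{-1} ≤ τ⁶`, `C₁τ ≤ 1/2`,
`L_t ≤ log(2/τ) + 2C₁/(τ log X)`, `e₀ ≤ 1`, `e₁ ≤ L_t`, `e₂ ≤ L_t²/2`, `W − 1 ≤ 12τ³`, the bracket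
`2(3B_w e₁ + L_t B_w e₀ + B_f e₁) + (W−1)e₂ + 72 L_t B_c e₀` is `≤ (600 + 400C₁ + 8 log(2C_N)) τ²`
(`B_w = 2(2ξL + log 2 + C₁)/(τL)`, `B_f = 2(2ξL + log(2C_N) + C₁)/(τL)`, `B_c = 2(ξL + C₁)/(τL)`): each
error of Lemma 3.7 for `U₂^{(1)}` is `O(ξτ^{-3}) + O(τ²(log τ^{-1})²)` times the main scale.
[cite: HeathBrownActa2001, §7 pp. 42–47] -/
theorem U2_scalars_le {τ L C₁ CN Lt e0 e1 e2 W : ℝ} (hτ : 0 < τ) (hτ1 : τ ≤ 1 / 40) (hL : 0 < L)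
    (hLτ : L⁻¹ ≤ τ ^ 6) (hC₁ : 0 ≤ C₁) (hC₁τ : C₁ * τ ≤ 1 / 2) (hCN1 : 1 ≤ CN)
    (hLt0 : 0 ≤ Lt) (hLt : Lt ≤ Real.log (2 / τ) + 2 * C₁ / (τ * L))
    (he0 : 0 ≤ e0) (he01 : e0 ≤ 1) (he1 : 0 ≤ e1) (he1L : e1 ≤ Lt) (he2 : 0 ≤ e2)
    (he2L : e2 ≤ Lt ^ 2 / 2) (hW : W - 1 ≤ 12 * τ ^ 3) :
    2 * (3 * (2 * (2 * hbXi τ * L + Real.log 2 + C₁) / (τ * L)) * e1 +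
          Lt * (2 * (2 * hbXi τ * L + Real.log 2 + C₁) / (τ * L)) * e0 +
          (2 * (2 * hbXi τ * L + Real.log (2 * CN) + C₁) / (τ * L)) * e1) +
      (W - 1) * e2 + 72 * (Lt * (2 * (hbXi τ * L + C₁) / (τ * L)) * e0) ≤
      (600 + 400 * C₁ + 8 * Real.log (2 * CN)) * τ ^ 2 := by
  have hξ : hbXi τ = τ ^ 5 := rfl
  have hτ1' : τ ≤ 1 := by linarith
  have hτL : 0 < τ * L := by positivity
  have hτ0 := hτ.le
  -- `1/(τL) ≤ τ⁵`
  have h1 : 1 / (τ * L) ≤ τ ^ 5 := by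
    have h := (inv_le_iff_one_le_mul₀ hL).mp hLτ
    rw [div_le_iff₀ hτL]
    nlinarith
  have hτ54 : τ ^ 5 ≤ τ ^ 4 := pow_le_pow_of_le_one hτ0 hτ1' (by norm_num)
  have hτ32 : τ ^ 3 ≤ τ ^ 2 := pow_le_pow_of_le_one hτ0 hτ1' (by norm_num)
  have hl2 : Real.log 2 ≤ 1 := by have := Real.log_two_lt_d9; linarith
  have hl20 : 0 ≤ Real.log 2 := Real.log_nonneg one_le_two
  have hlCN : 0 ≤ Real.log (2 * CN) := Real.log_nonneg (by linarith)
  -- the three window weights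
  set Bw : ℝ := 2 * (2 * hbXi τ * L + Real.log 2 + C₁) / (τ * L) with hBw
  set Bf : ℝ := 2 * (2 * hbXi τ * L + Real.log (2 * CN) + C₁) / (τ * L) with hBf
  set Bc : ℝ := 2 * (hbXi τ * L + C₁) / (τ * L) with hBc
  have hτne : τ ≠ 0 := hτ.ne'
  have hLne : L ≠ 0 := hL.ne'
  have eBw : Bw = 4 * τ ^ 4 + 2 * (Real.log 2 + C₁) * (1 / (τ * L)) := by
    rw [hBw, hξ]; field_simp; ring
  have eBf : Bf = 4 * τ ^ 4 + 2 * (Real.log (2 * CN) + C₁) * (1 / (τ * L)) := by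
    rw [hBf, hξ]; field_simp; ring
  have eBc : Bc = 2 * τ ^ 4 + 2 * C₁ * (1 / (τ * L)) := by
    rw [hBc, hξ]; field_simp
  have hBw_le : Bw ≤ (6 + 2 * C₁) * τ ^ 4 := by
    rw [eBw]
    have h2 : 2 * (Real.log 2 + C₁) * (1 / (τ * L)) ≤ 2 * (1 + C₁) * τ ^ 5 :=
      mul_le_mul (by linarith) h1 (by positivity) (by positivity)
    nlinarith [mul_le_mul_of_nonneg_left hτ54 (by positivity : (0 : ℝ) ≤ 2 * (1 + C₁))]
  have hBf_le : Bf ≤ (4 + 2 * Real.log (2 * CN) + 2 * C₁) * τ ^ 4 := by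
    rw [eBf]
    have h2 : 2 * (Real.log (2 * CN) + C₁) * (1 / (τ * L)) ≤ 2 * (Real.log (2 * CN) + C₁) * τ ^ 5 :=
      mul_le_mul_of_nonneg_left h1 (by positivity)
    nlinarith [mul_le_mul_of_nonneg_left hτ54 (by positivity : (0 : ℝ) ≤ 2 * (Real.log (2 * CN) + C₁))]
  have hBc_le : Bc ≤ (2 + 2 * C₁) * τ ^ 4 := by
    rw [eBc]
    have h2 : 2 * C₁ * (1 / (τ * L)) ≤ 2 * C₁ * τ ^ 5 := mul_le_mul_of_nonneg_left h1 (by positivity)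
    nlinarith [mul_le_mul_of_nonneg_left hτ54 (by positivity : (0 : ℝ) ≤ 2 * C₁)]
  have hξL : 0 ≤ hbXi τ * L := by rw [hξ]; positivity
  have hBw0 : 0 ≤ Bw := by
    rw [hBw]; exact div_nonneg (mul_nonneg zero_le_two (by linarith)) hτL.le
  have hBf0 : 0 ≤ Bf := by
    rw [hBf]; exact div_nonneg (mul_nonneg zero_le_two (by linarith)) hτL.le
  have hBc0 : 0 ≤ Bc := by
    rw [hBc]; exact div_nonneg (mul_nonneg zero_le_two (by linarith)) hτL.le
  -- `L_t ≤ Λ = log(2/τ) + 1 ≤ 2/τ`, `L_t² ≤ 8/τ`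
  obtain ⟨hΛ0, hΛ1, hΛ2⟩ := log_two_div_add_one_le hτ hτ1'
  have hLtΛ : Lt ≤ Real.log (2 / τ) + 1 := by
    have h2 : 2 * C₁ / (τ * L) = 2 * C₁ * (1 / (τ * L)) := by ring
    have h3 : 2 * C₁ * (1 / (τ * L)) ≤ 2 * C₁ * τ ^ 5 := mul_le_mul_of_nonneg_left h1 (by positivity)
    have h4 : τ ^ 5 ≤ τ := pow_le_of_le_one hτ0 hτ1' (by norm_num)
    have h5 : 2 * C₁ * τ ^ 5 ≤ 2 * C₁ * τ := mul_le_mul_of_nonneg_left h4 (by positivity)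
    linarith only [hLt, h2, h3, h5, hC₁τ]
  have hLt1 : Lt ≤ 2 / τ := hLtΛ.trans hΛ1
  have hLt2 : Lt ^ 2 ≤ 8 / τ := (pow_le_pow_left₀ hLt0 hLtΛ 2).trans hΛ2
  have he1' : e1 ≤ 2 / τ := he1L.trans hLt1
  -- products
  have p1 : Bw * e1 ≤ (6 + 2 * C₁) * τ ^ 4 * (2 / τ) := mul_le_mul hBw_le he1' he1 (by positivity)
  have p2 : Lt * Bw * e0 ≤ (2 / τ) * ((6 + 2 * C₁) * τ ^ 4) * 1 :=
    mul_le_mul (mul_le_mul hLt1 hBw_le hBw0 (by positivity)) he01 he0 (by positivity)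
  have p3 : Bf * e1 ≤ (4 + 2 * Real.log (2 * CN) + 2 * C₁) * τ ^ 4 * (2 / τ) :=
    mul_le_mul hBf_le he1' he1 (by positivity)
  have p4 : (W - 1) * e2 ≤ 12 * τ ^ 3 * (8 / τ / 2) :=
    mul_le_mul hW (he2L.trans (by linarith)) he2 (by positivity)
  have p5 : Lt * Bc * e0 ≤ (2 / τ) * ((2 + 2 * C₁) * τ ^ 4) * 1 :=
    mul_le_mul (mul_le_mul hLt1 hBc_le hBc0 (by positivity)) he01 he0 (by positivity)
  have e1' : (6 + 2 * C₁) * τ ^ 4 * (2 / τ) = (12 + 4 * C₁) * τ ^ 3 := by field_simp; ring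
  have e2' : (2 / τ) * ((6 + 2 * C₁) * τ ^ 4) * 1 = (12 + 4 * C₁) * τ ^ 3 := by field_simp; ring
  have e3' : (4 + 2 * Real.log (2 * CN) + 2 * C₁) * τ ^ 4 * (2 / τ) =
      (8 + 4 * Real.log (2 * CN) + 4 * C₁) * τ ^ 3 := by field_simp; ring
  have e4' : 12 * τ ^ 3 * (8 / τ / 2) = 48 * τ ^ 2 := by field_simp; norm_num
  have e5' : (2 / τ) * ((2 + 2 * C₁) * τ ^ 4) * 1 = (4 + 4 * C₁) * τ ^ 3 := by field_simp; ring
  rw [e1'] at p1; rw [e2'] at p2; rw [e3'] at p3; rw [e4'] at p4; rw [e5'] at p5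
  have hτ3 : 0 ≤ τ ^ 3 := by positivity
  have hτ2 : 0 ≤ τ ^ 2 := by positivity
  have key : 2 * (3 * Bw * e1 + Lt * Bw * e0 + Bf * e1) + (W - 1) * e2 + 72 * (Lt * Bc * e0) ≤
      48 * τ ^ 2 + (400 + 328 * C₁ + 8 * Real.log (2 * CN)) * τ ^ 3 := by
    linarith only [p1, p2, p3, p4, p5]
  refine key.trans ?_
  have h6 := mul_le_mul_of_nonneg_left hτ32 (by positivity : (0:ℝ) ≤ 400 + 328 * C₁ + 8 * Real.log (2 * CN))
  have h7 : (0:ℝ) ≤ C₁ * τ ^ 2 := by positivity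
  linarith only [h6, h7, hτ2]

end Scalars
section FinalTools

variable {X η τ : ℝ}

/-- The parameters of the `U₂^{(1)}`-bounds, eventually in `X`: `2^{15} ≤ X`, `0 < τ ≤ 1/40`,
`(log X)^{-1} ≤ τ⁶`, `C₁τ ≤ 1/2`, `4 ≤ τ log X`, and the absorption inequality
`X^{−τ/5}(log X)³ ≤ τe^{−2(log X)^{1/3}}/log X` (`τ = (log log X)^{−ϖ}`). [folklore] -/
theorem eventually_U2_params {ϖ : ℝ} (hϖ0 : 0 < ϖ) (hϖ1 : ϖ ≤ 1) {C₁ : ℝ} (hC₁ : 0 ≤ C₁) (X₇ : ℝ) :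
    ∀ᶠ X : ℝ in atTop, X₇ ≤ X ∧ (2 : ℝ) ^ 15 ≤ X ∧ 0 < hbTau ϖ X ∧ hbTau ϖ X ≤ 1 / 40 ∧
      (Real.log X)⁻¹ ≤ hbTau ϖ X ^ 6 ∧ C₁ * hbTau ϖ X ≤ 1 / 2 ∧ 4 ≤ hbTau ϖ X * Real.log X ∧
      X ^ (-hbTau ϖ X / 5) * Real.log X ^ 3 ≤
        hbTau ϖ X * Real.exp (-2 * Real.log X ^ (1 / 3 : ℝ)) / Real.log X := by
  have hc : (0 : ℝ) < min (1 / 40) (1 / (2 * C₁ + 2)) := lt_min (by norm_num) (by positivity)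
  filter_upwards [(eventually_upperBound_params hϖ0 hϖ1 one_pos 3),
    (eventually_hbTau_pow_mul_log hϖ0 hϖ1 6 1 hc), (eventually_le_hbTau_mul_log hϖ1 4),
    eventually_ge_atTop (max X₇ ((2 : ℝ) ^ 15))] with X h1 h2 h3 h4
  obtain ⟨-, hτ0, -, -, habs⟩ := h1
  obtain ⟨hL6, hτc⟩ := h2
  have hτ40 : hbTau ϖ X ≤ 1 / 40 := hτc.trans (min_le_left _ _)
  have hτC : hbTau ϖ X ≤ 1 / (2 * C₁ + 2) := hτc.trans (min_le_right _ _)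
  have hC₁τ : C₁ * hbTau ϖ X ≤ 1 / 2 := by
    calc C₁ * hbTau ϖ X ≤ C₁ * (1 / (2 * C₁ + 2)) := mul_le_mul_of_nonneg_left hτC hC₁
      _ ≤ 1 / 2 := by
        rw [mul_one_div, div_le_iff₀ (by positivity)]; linarith
  have hX15 : (2 : ℝ) ^ 15 ≤ X := le_trans (le_max_right _ _) h4
  have hL10 : 10 ≤ Real.log X := ten_le_log hX15
  have hLinv : (Real.log X)⁻¹ ≤ hbTau ϖ X ^ 6 := by
    rw [inv_le_iff_one_le_mul₀ (by linarith)]; linarith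
  refine ⟨le_trans (le_max_left _ _) h4, hX15, hτ0, hτ40, hLinv, hC₁τ, h3, ?_⟩
  rw [one_mul] at habs; exact habs

/-- From `4 ≤ τ log X`: `16 ≤ X^τ` (indeed `e⁴ > 16`) and `24 < X^{3τ}`. [folklore] -/
theorem rpow_tau_bounds (hX : 1 < X) (hτL : 4 ≤ τ * Real.log X) :
    16 ≤ X ^ τ ∧ 4 ≤ X ^ τ ∧ (24 : ℝ) < X ^ (3 * τ) := by
  have hX0 : 0 < X := by linarith
  have he : (2 : ℝ) < Real.exp 1 := by have := Real.exp_one_gt_d9; linarith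
  have h1 : Real.exp 4 ≤ X ^ τ := by
    rw [Real.rpow_def_of_pos hX0]
    exact Real.exp_le_exp.mpr (by linarith)
  have h4 : (16 : ℝ) ≤ Real.exp 4 := by
    have h3 : Real.exp 4 = Real.exp 1 ^ 4 := by rw [← Real.exp_nat_mul]; norm_num
    rw [h3]
    calc (16 : ℝ) = 2 ^ 4 := by norm_num
      _ ≤ Real.exp 1 ^ 4 := pow_le_pow_left₀ (by norm_num) he.le 4
  have h2 : Real.exp 12 ≤ X ^ (3 * τ) := by
    rw [Real.rpow_def_of_pos hX0]
    exact Real.exp_le_exp.mpr (by nlinarith)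
  have h12 : (24 : ℝ) < Real.exp 12 := by
    have h3 : Real.exp 12 = Real.exp 1 ^ 12 := by rw [← Real.exp_nat_mul]; norm_num
    rw [h3]
    calc (24 : ℝ) < 2 ^ 12 := by norm_num
      _ ≤ Real.exp 1 ^ 12 := pow_le_pow_left₀ (by norm_num) he.le 12
  exact ⟨h4.trans h1, by linarith, h12.trans_le h2⟩

/-- `ηX ≥ 1` for `η ≥ exp(−(log X)^{1/3})`, `X ≥ e`. [folklore] -/
theorem one_le_eta_mul (hX : Real.exp 1 ≤ X) (hη : Real.exp (-Real.log X ^ (1 / 3 : ℝ)) ≤ η) :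
    1 ≤ η * X := by
  have hX0 : 0 < X := lt_of_lt_of_le (Real.exp_pos 1) hX
  have hL1 : 1 ≤ Real.log X := by
    rw [← Real.log_exp 1]; exact Real.log_le_log (Real.exp_pos 1) hX
  have hL0 : 0 ≤ Real.log X := by linarith
  have h13 : Real.log X ^ (1 / 3 : ℝ) ≤ Real.log X := by
    calc Real.log X ^ (1 / 3 : ℝ) ≤ Real.log X ^ (1 : ℝ) :=
          Real.rpow_le_rpow_of_exponent_le hL1 (by norm_num)
      _ = Real.log X := Real.rpow_one _
  have hη0 : 0 < Real.exp (-Real.log X ^ (1 / 3 : ℝ)) := Real.exp_pos _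
  calc (1 : ℝ) = Real.exp (-Real.log X ^ (1 / 3 : ℝ)) * Real.exp (Real.log X ^ (1 / 3 : ℝ)) := by
        rw [← Real.exp_add]; simp
    _ ≤ Real.exp (-Real.log X ^ (1 / 3 : ℝ)) * X := by
        refine mul_le_mul_of_nonneg_left ?_ hη0.le
        calc Real.exp (Real.log X ^ (1 / 3 : ℝ)) ≤ Real.exp (Real.log X) := Real.exp_le_exp.mpr h13
          _ = X := Real.exp_log hX0
    _ ≤ η * X := mul_le_mul_of_nonneg_right hη hX0.le

open scoped Classical in
/-- **The square defect for `𝒜^(K)`**: `∑_Q #𝒜^(K)_{Q²}` over the first-degree primes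
`X^{1/2} ≤ N(Q) < X^{1−τ}` is at most `9(ηX+1)(4(ηX+1)X^{−1/2} + X^{1−τ} + 1)` (`Q² ∣ (x + y·2^{1/3})`
forces `q² ∣ x³ + 2y³`; `−2` has `≤ 3` cube roots mod `q²`; `≤ 3` ideals per norm; `∑_{q ≥ √X} q^{-2} ≤ 4X^{-1/2}`).
[cite: HeathBrownActa2001, §7 (7.5)–(7.6)] -/
theorem sqDefect_A_le (hX : (2 : ℝ) ^ 15 ≤ X) (hη : 0 < η) (hτ : 0 < τ) (hτ1 : τ ≤ 1 / 2) :
    ∑ Q ∈ (primesNormIco (X ^ (1 / 2 : ℝ)) (X ^ (1 - τ))).filter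
        (fun Q => (Ideal.absNorm Q).Prime), (famCount (boxPairs X η) pairIdeal (Q * Q) : ℝ) ≤
      9 * (η * X + 1) * (4 * (η * X + 1) * X ^ (-(1 / 2 : ℝ)) + (X ^ (1 - τ) + 1)) := by
  classical
  have hX1 : 1 < X := lt_of_lt_of_le (by norm_num) hX
  have hX0 : 0 < X := by linarith
  set S := (primesNormIco (X ^ (1 / 2 : ℝ)) (X ^ (1 - τ))).filter
    (fun Q => (Ideal.absNorm Q).Prime) with hS
  have hSmem : ∀ Q ∈ S, Q.IsPrime ∧ Q ≠ ⊥ ∧ (Ideal.absNorm Q).Prime ∧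
      X ^ (1 / 2 : ℝ) ≤ (Ideal.absNorm Q : ℝ) ∧ (Ideal.absNorm Q : ℝ) < X ^ (1 - τ) := by
    intro Q hQ
    rw [hS, mem_filter, mem_primesNormIco_iff] at hQ
    exact ⟨hQ.1.1, hQ.1.2.1, hQ.2, hQ.1.2.2.1, hQ.1.2.2.2⟩
  have hsqrt : (32 : ℝ) ≤ X ^ (1 / 2 : ℝ) := by
    have h1 : ((2 : ℝ) ^ 15) ^ (1 / 2 : ℝ) ≤ X ^ (1 / 2 : ℝ) :=
      Real.rpow_le_rpow (by norm_num) hX (by norm_num)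
    have h2 : (32 : ℝ) ≤ ((2 : ℝ) ^ 15) ^ (1 / 2 : ℝ) := by
      rw [show ((2 : ℝ) ^ 15) = (2 ^ (15 : ℝ)) by norm_num, ← Real.rpow_mul (by norm_num)]
      have : (32 : ℝ) = 2 ^ (5 : ℝ) := by norm_num
      rw [this]
      exact Real.rpow_le_rpow_of_exponent_le (by norm_num) (by norm_num)
    exact h2.trans h1
  -- the bound at one prime
  set g : ℕ → ℝ := fun q => 3 * (η * X + 1) * ((η * X + 1) / (q : ℝ) ^ 2 + 1) with hg
  have hg0 : ∀ q, 0 ≤ g q := fun q => by rw [hg]; positivity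
  have hterm : ∀ Q ∈ S, (famCount (boxPairs X η) pairIdeal (Q * Q) : ℝ) ≤ g (Ideal.absNorm Q) := by
    intro Q hQ
    obtain ⟨-, -, hpr, hlo, -⟩ := hSmem Q hQ
    have hq5 : 5 ≤ Ideal.absNorm Q := by
      have : (5 : ℝ) ≤ Ideal.absNorm Q := by linarith
      exact_mod_cast this
    have hsub : APairs X η (Q * Q) ⊆ (boxPairs X η).filter
        (fun xy => Ideal.absNorm Q ^ 2 ∣ xy.1 ^ 3 + 2 * xy.2 ^ 3) := by
      intro xy hxy
      obtain ⟨hbox, hdvd⟩ := mem_APairs_iff.mp hxy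
      refine mem_filter.mpr ⟨hbox, ?_⟩
      have h := Ideal.absNorm_dvd_absNorm_of_le (Ideal.le_of_dvd hdvd)
      rwa [map_mul, absNorm_pairIdeal, ← sq] at h
    rw [famCount_boxPairs, countA]
    calc (#(APairs X η (Q * Q)) : ℝ) ≤ #((boxPairs X η).filter
          (fun xy => Ideal.absNorm Q ^ 2 ∣ xy.1 ^ 3 + 2 * xy.2 ^ 3)) := by exact_mod_cast card_le_card hsub
      _ ≤ g (Ideal.absNorm Q) := card_boxPairs_sq_dvd_le hX0 hη hpr hq5
  have step1 : ∑ Q ∈ S, (famCount (boxPairs X η) pairIdeal (Q * Q) : ℝ) ≤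
      3 * ∑ q ∈ S.image Ideal.absNorm, g q :=
    (sum_le_sum hterm).trans (sum_primes_le_three_mul_sum_image S (fun Q hQ => ⟨(hSmem Q hQ).1, (hSmem Q hQ).2.1⟩) hg0)
  -- the sum over the norms
  have himg : ∀ q ∈ S.image Ideal.absNorm, X ^ (1 / 2 : ℝ) ≤ (q : ℝ) ∧ (q : ℝ) < X ^ (1 - τ) := by
    intro q hq
    obtain ⟨Q, hQ, rfl⟩ := mem_image.mp hq
    exact ⟨(hSmem Q hQ).2.2.2.1, (hSmem Q hQ).2.2.2.2⟩
  have hsq : ∑ q ∈ S.image Ideal.absNorm, ((q : ℝ) ^ 2)⁻¹ ≤ 4 * X ^ (-(1 / 2 : ℝ)) := by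
    have hy : (2 : ℝ) ≤ X ^ (1 / 2 : ℝ) / 2 := by linarith
    have h := sum_inv_sq_tail_le hy (S.image Ideal.absNorm) (fun q hq => by
      have := (himg q hq).1
      have hpos : 0 < X ^ (1 / 2 : ℝ) := by positivity
      linarith)
    refine h.trans (le_of_eq ?_)
    rw [Real.rpow_neg hX0.le]; field_simp; ring
  have hcard : (#(S.image Ideal.absNorm) : ℝ) ≤ X ^ (1 - τ) + 1 := by
    have hsub : S.image Ideal.absNorm ⊆ range (⌊X ^ (1 - τ)⌋₊ + 1) := by
      intro q hq
      rw [mem_range]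
      have := (himg q hq).2
      have : q ≤ ⌊X ^ (1 - τ)⌋₊ := Nat.le_floor this.le
      omega
    calc (#(S.image Ideal.absNorm) : ℝ) ≤ #(range (⌊X ^ (1 - τ)⌋₊ + 1)) := by exact_mod_cast card_le_card hsub
      _ = ⌊X ^ (1 - τ)⌋₊ + 1 := by rw [card_range]; push_cast; ring
      _ ≤ X ^ (1 - τ) + 1 := by linarith [Nat.floor_le (Real.rpow_nonneg hX0.le (1 - τ))]
  have step2 : ∑ q ∈ S.image Ideal.absNorm, g q ≤
      3 * (η * X + 1) * ((η * X + 1) * (4 * X ^ (-(1 / 2 : ℝ))) + (X ^ (1 - τ) + 1)) := by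
    have e : ∑ q ∈ S.image Ideal.absNorm, g q =
        3 * (η * X + 1) * ((η * X + 1) * ∑ q ∈ S.image Ideal.absNorm, ((q : ℝ) ^ 2)⁻¹ +
          #(S.image Ideal.absNorm)) := by
      simp only [hg]
      rw [← mul_sum, sum_add_distrib, sum_const, nsmul_eq_mul, mul_one, mul_sum]
      congr 1
    rw [e]
    have hηX : 0 ≤ η * X + 1 := by positivity
    refine mul_le_mul_of_nonneg_left (add_le_add (mul_le_mul_of_nonneg_left hsq hηX) hcard) (by positivity)
  calc ∑ Q ∈ S, (famCount (boxPairs X η) pairIdeal (Q * Q) : ℝ) ≤ 3 * ∑ q ∈ S.image Ideal.absNorm, g q := step1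
    _ ≤ 3 * (3 * (η * X + 1) * ((η * X + 1) * (4 * X ^ (-(1 / 2 : ℝ))) + (X ^ (1 - τ) + 1))) :=
        mul_le_mul_of_nonneg_left step2 (by norm_num)
    _ = _ := by ring

/-- Absorption of the square defect of `𝒜^(K)`: with `ηX ≥ 1`, `X^{−1/2} ≤ X^{−τ/5} ≤ τη²/log X`
(from the absorption inequality), `9(ηX+1)(4(ηX+1)X^{−1/2} + X^{1−τ} + 1) ≤ 180 τη²X²/log X`.
[folklore] -/
theorem sqDefect_A_absorb (hX : 1 < X) (hτ : 0 < τ) (hτ1 : τ ≤ 1 / 2) (hη1 : η ≤ 1) (hηX : 1 ≤ η * X)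
    {L : ℝ} (hL1 : 1 ≤ L) (habs : X ^ (-τ / 5) * L ^ 3 ≤ τ * η ^ 2 / L) :
    9 * (η * X + 1) * (4 * (η * X + 1) * X ^ (-(1 / 2 : ℝ)) + (X ^ (1 - τ) + 1)) ≤
      180 * (τ * η ^ 2 * X ^ 2 / L) := by
  have hX0 : 0 < X := by linarith
  have hη0 : 0 < η := by
    by_contra h; push Not at h
    nlinarith
  have hL0 : 0 < L := by linarith
  -- `X^{-τ/5} ≤ τη²/L`
  have hsmall : X ^ (-τ / 5) ≤ τ * η ^ 2 / L := by
    have h1 : X ^ (-τ / 5) ≤ X ^ (-τ / 5) * L ^ 3 := by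
      have : (1 : ℝ) ≤ L ^ 3 := one_le_pow₀ hL1
      have h0 : 0 ≤ X ^ (-τ / 5) := Real.rpow_nonneg hX0.le _
      nlinarith
    exact h1.trans habs
  have hhalf : X ^ (-(1 / 2 : ℝ)) ≤ X ^ (-τ / 5) := Real.rpow_le_rpow_of_exponent_le hX.le (by linarith)
  have hτ' : X ^ (-τ) ≤ X ^ (-τ / 5) := Real.rpow_le_rpow_of_exponent_le hX.le (by linarith)
  have h1τ : (1 : ℝ) ≤ X ^ (1 - τ) := Real.one_le_rpow hX.le (by linarith)
  have e1 : X * X ^ (1 - τ) = X ^ 2 * X ^ (-τ) := by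
    rw [show X ^ 2 = X ^ (2 : ℝ) by norm_cast, ← Real.rpow_add hX0,
      show X * X ^ (1 - τ) = X ^ (1 : ℝ) * X ^ (1 - τ) by rw [Real.rpow_one], ← Real.rpow_add hX0]
    ring_nf
  -- first term
  have hA : 9 * (η * X + 1) * (4 * (η * X + 1) * X ^ (-(1 / 2 : ℝ))) ≤ 144 * (τ * η ^ 2 * X ^ 2 / L) := by
    have h2 : η * X + 1 ≤ 2 * (η * X) := by linarith
    have h3 : 0 ≤ X ^ (-(1 / 2 : ℝ)) := Real.rpow_nonneg hX0.le _
    calc 9 * (η * X + 1) * (4 * (η * X + 1) * X ^ (-(1 / 2 : ℝ)))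
        = 36 * (η * X + 1) ^ 2 * X ^ (-(1 / 2 : ℝ)) := by ring
      _ ≤ 36 * (2 * (η * X)) ^ 2 * X ^ (-τ / 5) := by
          refine mul_le_mul (mul_le_mul_of_nonneg_left (pow_le_pow_left₀ (by positivity) h2 2) (by norm_num))
            hhalf h3 (by positivity)
      _ = 144 * (η ^ 2 * X ^ 2) * X ^ (-τ / 5) := by ring
      _ ≤ 144 * (η ^ 2 * X ^ 2) * (τ * η ^ 2 / L) := mul_le_mul_of_nonneg_left hsmall (by positivity)
      _ ≤ 144 * (τ * η ^ 2 * X ^ 2 / L) := by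
          have hη2 : η ^ 2 ≤ 1 := by nlinarith
          have : 144 * (η ^ 2 * X ^ 2) * (τ * η ^ 2 / L) = (144 * (τ * η ^ 2 * X ^ 2 / L)) * η ^ 2 := by ring
          rw [this]
          have h0 : 0 ≤ 144 * (τ * η ^ 2 * X ^ 2 / L) := by positivity
          nlinarith
  -- second term
  have hB : 9 * (η * X + 1) * (X ^ (1 - τ) + 1) ≤ 36 * (τ * η ^ 2 * X ^ 2 / L) := by
    calc 9 * (η * X + 1) * (X ^ (1 - τ) + 1) ≤ 9 * (2 * (η * X)) * (2 * X ^ (1 - τ)) :=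
          mul_le_mul (mul_le_mul_of_nonneg_left (by linarith) (by norm_num)) (by linarith)
            (by positivity) (by positivity)
      _ = 36 * η * (X * X ^ (1 - τ)) := by ring
      _ = 36 * η * (X ^ 2 * X ^ (-τ)) := by rw [e1]
      _ ≤ 36 * η * (X ^ 2 * (τ * η ^ 2 / L)) := by
          refine mul_le_mul_of_nonneg_left (mul_le_mul_of_nonneg_left (hτ'.trans hsmall) (by positivity)) (by positivity)
      _ = (36 * (τ * η ^ 2 * X ^ 2 / L)) * η := by ring
      _ ≤ 36 * (τ * η ^ 2 * X ^ 2 / L) := by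
          have h0 : 0 ≤ 36 * (τ * η ^ 2 * X ^ 2 / L) := by positivity
          nlinarith
  calc 9 * (η * X + 1) * (4 * (η * X + 1) * X ^ (-(1 / 2 : ℝ)) + (X ^ (1 - τ) + 1))
      = 9 * (η * X + 1) * (4 * (η * X + 1) * X ^ (-(1 / 2 : ℝ))) + 9 * (η * X + 1) * (X ^ (1 - τ) + 1) := by ring
    _ ≤ 144 * (τ * η ^ 2 * X ^ 2 / L) + 36 * (τ * η ^ 2 * X ^ 2 / L) := add_le_add hA hB
    _ = 180 * (τ * η ^ 2 * X ^ 2 / L) := by ring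

end FinalTools
section Bound

variable {ι : Type*} (E : Finset ι) (I : ι → Ideal (𝓞 K)) {X τ C₇ C₁ M Err CN : ℝ}

open scoped Classical in
/-- **`|U₂^{(1)} − Û₂^{(1)}|` from Lemma 7.1 for a general family.** With `h7` the conclusion of the
corrected Lemma 7.1 for the sifting functions of the family (main term `M`, error `Err`),
`2^{15} ≤ X`, `0 < τ ≤ 1/40`, `(log X)^{-1} ≤ τ⁶`, `C₁τ ≤ 1/2`, members `X³ < N(I_i) ≤ C_N X³`
(`1 ≤ C_N < X^{3τ}`):
`|U₂^{(1)} − Û₂^{(1)}| ≤ RAW + C₇(600 + 400C₁ + 8 log(2C_N))·τM/log X + 225 C₇·Err·log X`, where RAW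
consists of the family-dependent counts `#𝒵_{P₁P₂}` over non-good pairs, `#𝒵_{QQ'}` over
equal-norm pairs, `#𝒵_Q` over primes of degree `≥ 2`, `#𝒵_{Q²}` — zero or polynomially small for
`𝒜^(K)`, `ℬ^(K)` (pp. 45–47). [cite: HeathBrownActa2001, §7 pp. 46–47] -/
theorem U2_bound_of_h7 (hC₁ : 0 ≤ C₁)
    (hwin : ∀ (lo hi : ℝ) (T : Finset ℕ), 2 ≤ lo → lo ≤ hi →
      (∀ p ∈ T, p.Prime ∧ lo < (p : ℝ) ∧ (p : ℝ) ≤ hi) →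
      ∑ p ∈ T, (idealNormCount K p : ℝ) * (p : ℝ)⁻¹ ≤
        Real.log (Real.log hi / Real.log lo) + C₁ / Real.log lo)
    (hX : (2 : ℝ) ^ 15 ≤ X) (hτ : 0 < τ) (hτ1 : τ ≤ 1 / 40) (hXτ : 4 ≤ X ^ τ)
    (hLτ : (Real.log X)⁻¹ ≤ τ ^ 6) (hC₁τ : C₁ * τ ≤ 1 / 2) (hCN1 : 1 ≤ CN) (hCN : CN < X ^ (3 * τ))
    (hE : ∀ i ∈ E, I i ≠ ⊥ ∧ X ^ 3 < (Ideal.absNorm (I i) : ℝ) ∧ (Ideal.absNorm (I i) : ℝ) ≤ CN * X ^ 3)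
    (hC₇ : 0 ≤ C₇) (hM : 0 ≤ M) (hErr : 0 ≤ Err)
    (h7 : ∀ (N z : ℝ) (𝒬 : Finset ℕ), X ^ τ ≤ z → 0 < N → N ≤ X ^ (2 - 2 * τ) →
        (∀ q ∈ 𝒬, Squarefree q ∧ N < q ∧ (q : ℝ) ≤ 2 * N) →
        ∑ Q ∈ normIn 𝒬, (famSifted E I Q z : ℝ) ≤
          C₇ * (M / Real.log (min z (X ^ (2 - τ) / N)) *
            ∑ Q ∈ normIn 𝒬, ((Ideal.absNorm Q : ℕ) : ℝ)⁻¹ + Err)) :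
    |(U2one E I X τ : ℝ) - U2hat X τ E I| ≤
      ∑ t ∈ (Upairs X τ 1).filter (fun t => ¬ UGood t), (famCount E I (uIdeal t) : ℝ) +
      72 * (∑ x ∈ (primesNormIco (X ^ (1 / 2 : ℝ)) (CN * X ^ 3 + 1) ×ˢ
              primesNormIco (X ^ (1 / 2 : ℝ)) (CN * X ^ 3 + 1)).filter
              (fun x => x.1 ≠ x.2 ∧ Ideal.absNorm x.1 = Ideal.absNorm x.2),
              (famCount E I (x.1 * x.2) : ℝ) +
            ∑ Q ∈ (primesNormIco (X ^ (1 / 2 : ℝ)) (CN * X ^ 3 + 1)).filter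
              (fun Q => ¬ (Ideal.absNorm Q).Prime), (famCount E I Q : ℝ) +
            ∑ Q ∈ (primesNormIco (X ^ (1 / 2 : ℝ)) (X ^ (1 - τ))).filter
              (fun Q => (Ideal.absNorm Q).Prime), (famCount E I (Q * Q) : ℝ)) +
      C₇ * (600 + 400 * C₁ + 8 * Real.log (2 * CN)) * (τ * M / Real.log X) +
      225 * Real.log X * (C₇ * Err) := by
  classical
  have hX1 : 1 < X := lt_of_lt_of_le (by norm_num) hX
  have hX0 : 0 < X := by linarith
  have hτ8 : τ ≤ 1 / 8 := by linarith
  set L := Real.log X with hL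
  have hL10 : 10 ≤ L := ten_le_log hX
  have hL0 : 0 < L := by linarith
  obtain ⟨hμ1, hμle, -⟩ := mu_props hτ (by linarith)
  have hbase := U2_abs_sub_le E I hX1 hτ hτ1 hCN1 hCN hE hμ1 hμle
  have hA := U2_goodClass_sum_le E I hC₁ hwin hX hτ hτ8 hXτ hCN1 hC₇ hM hErr h7
  have hB := U2_goodAll_sum_le E I hX hτ hτ8 hC₇ hM hErr h7
  have hC := U2_closePairs_sum_le E I hC₁ hwin hX hτ hτ8 hXτ hC₇ hM hErr h7
  obtain ⟨hW, hW1⟩ := U2_weight_sub_one_le hτ hτ1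
  -- abbreviations
  set P0 := (range (⌊X ^ (1 - τ)⌋₊ + 1)).filter
    (fun p : ℕ => p.Prime ∧ X ^ τ ≤ (p : ℝ) ∧ (p : ℝ) < X ^ (1 - τ)) with hP0
  set w : ℕ → ℝ := fun p => (idealNormCount K p : ℝ) * (p : ℝ)⁻¹ with hw
  set Lt : ℝ := ∑ p ∈ P0, w p with hLt
  set e0 : ℝ := ∑ σ' ∈ P0.powersetCard 0, ∏ p ∈ σ', w p with he0
  set e1 : ℝ := ∑ σ' ∈ P0.powersetCard 1, ∏ p ∈ σ', w p with he1
  set e2 : ℝ := ∑ σ' ∈ P0.powersetCard 2, ∏ p ∈ σ', w p with he2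
  set Bw : ℝ := 2 * (2 * hbXi τ * L + Real.log 2 + C₁) / (τ * L) with hBw
  set Bf : ℝ := 2 * (2 * hbXi τ * L + Real.log (2 * CN) + C₁) / (τ * L) with hBf
  set Bc : ℝ := 2 * (hbXi τ * L + C₁) / (τ * L) with hBc
  set W1 : ℝ := (1 + 1 / ((⌊τ / hbXi τ⌋₊ : ℕ) : ℝ)) ^ (u2Bound τ + 1) - 1 with hW1def
  set c : ℝ := C₇ * (M / (τ * L)) with hc
  set er : ℝ := 3 * L * (C₇ * Err) with her
  have hc0 : 0 ≤ c := by rw [hc]; positivity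
  have her0 : 0 ≤ er := by rw [her]; positivity
  have hW10 : 0 ≤ W1 := by
    rw [hW1def, sub_nonneg]
    exact one_le_pow₀ (by
      have : (0 : ℝ) ≤ 1 / ((⌊τ / hbXi τ⌋₊ : ℕ) : ℝ) := by positivity
      linarith)
  -- the symmetric sums
  have hwnn : ∀ p ∈ P0, 0 ≤ w p := normWt_nonneg_on P0
  have hLt0 : 0 ≤ Lt := sum_nonneg hwnn
  have hLtb : Lt ≤ Real.log (2 / τ) + 2 * C₁ / (τ * L) :=
    smallPrimes_normWt_le hC₁ hwin hX1 hτ (by linarith) hXτ P0 fun p hp => mem_P0_iff.mp hp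
  have he00 : 0 ≤ e0 := esymm_nonneg P0 w hwnn 0
  have he10 : 0 ≤ e1 := esymm_nonneg P0 w hwnn 1
  have he20 : 0 ≤ e2 := esymm_nonneg P0 w hwnn 2
  have he01 : e0 ≤ 1 := by
    have h := esymm_le_pow_div_factorial P0 w hwnn 0
    rw [pow_zero, Nat.factorial_zero, Nat.cast_one, div_one] at h
    exact h
  have he1L : e1 ≤ Lt := by
    have h := esymm_le_pow_div_factorial P0 w hwnn 1
    rw [pow_one, Nat.factorial_one, Nat.cast_one, div_one] at h
    exact h
  have he2L : e2 ≤ Lt ^ 2 / 2 := by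
    have h := esymm_le_pow_div_factorial P0 w hwnn 2
    rw [Nat.factorial_two] at h
    exact_mod_cast h
  have hS := U2_scalars_le (CN := CN) (W := W1 + 1) hτ hτ1 hL0 hLτ hC₁ hC₁τ hCN1 hLt0 hLtb he00 he01 he10 he1L
    he20 he2L (by rw [add_sub_cancel_right]; exact hW)
  rw [add_sub_cancel_right] at hS
  -- multiply the three family bounds
  have hB' : W1 * ∑ t ∈ (Upairs X τ 1).filter (fun t => UGood t), (famSifted E I (uIdeal t) (X ^ τ) : ℝ) ≤
      W1 * (c * e2 + er) := mul_le_mul_of_nonneg_left hB hW10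
  have hW1er : W1 * er ≤ 1 * er := mul_le_mul_of_nonneg_right (hW.trans hW1) her0
  have hSc : c * (2 * (3 * Bw * e1 + Lt * Bw * e0 + Bf * e1) + W1 * e2 + 72 * (Lt * Bc * e0)) ≤
      c * ((600 + 400 * C₁ + 8 * Real.log (2 * CN)) * τ ^ 2) := mul_le_mul_of_nonneg_left hS hc0
  have e : c * ((600 + 400 * C₁ + 8 * Real.log (2 * CN)) * τ ^ 2) =
      C₇ * (600 + 400 * C₁ + 8 * Real.log (2 * CN)) * (τ * M / L) := by
    rw [hc]; field_simp
  have e' : (75 : ℝ) * er = 225 * L * (C₇ * Err) := by rw [her]; ring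
  -- nonnegativity of the raw sums
  have hT1 : 0 ≤ ∑ t ∈ (Upairs X τ 1).filter (fun t => ¬ UGood t), (famCount E I (uIdeal t) : ℝ) :=
    sum_nonneg fun _ _ => Nat.cast_nonneg _
  linarith [hbase, hA, hB', hC, hW1er, hSc, e, e']

end Bound
section Final

variable {X η τ : ℝ}

open scoped Classical in
/-- **Lemma 3.7 for `U₂^{(1)}(𝒜)` from the corrected Lemma 7.1**:
`|U₂^{(1)}(𝒜) − Û₂^{(1)}(𝒜)| ≤ C ξτ^{-4} η²X²/log X` for `X ≥ X₀`, `η` in (2.1). For `𝒜^(K)` the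
non-good pairs, equal-norm pairs and degree-`≥ 2` primes contribute nothing (Lemma 3.1) and the
square defect is `≪ η²X^{3/2} + ηX^{2−τ}` ((7.5)–(7.6)). [cite: HeathBrownActa2001, Lemma 3.7] -/
theorem U2_A_bound (h71 : HeathBrown2001_lemma_7_1_normWeighted) {ϖ : ℝ} (hϖ0 : 0 < ϖ)
    (hϖ1 : ϖ < 1 / 5) :
    ∃ C X₀ : ℝ, ∀ X η : ℝ, X₀ ≤ X → Real.exp (-Real.log X ^ (1 / 3 : ℝ)) ≤ η → η ≤ 1 →
      |(U2one (boxPairs X η) pairIdeal X (hbTau ϖ X) : ℝ) -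
          U2hat X (hbTau ϖ X) (boxPairs X η) pairIdeal| ≤
        C * (hbXi (hbTau ϖ X) / hbTau ϖ X ^ 4) * (η ^ 2 * X ^ 2 / Real.log X) := by
  classical
  obtain ⟨C₇, X₇, h7⟩ := h71 ϖ hϖ0 hϖ1
  obtain ⟨C₁, hC₁, hwin⟩ := exists_sum_normWt_window_le
  have hϖ1' : ϖ ≤ 1 := by linarith
  set C₇' : ℝ := max C₇ 1 with hC₇'
  have hC₇'0 : 0 ≤ C₇' := le_trans zero_le_one (le_max_right _ _)
  have hCC : C₇ ≤ C₇' := le_max_left _ _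
  obtain ⟨X₁, hX₁⟩ := Filter.eventually_atTop.mp (eventually_U2_params hϖ0 hϖ1' hC₁ X₇)
  refine ⟨C₇' * (600 + 400 * C₁ + 8 * Real.log (2 * 24) + 225) + 72 * 180, X₁, fun X η hX hη hη1 => ?_⟩
  obtain ⟨hX7, hX15, hτ0, hτ40, hLτ, hC₁τ, hτL, habs⟩ := hX₁ X hX
  set τ := hbTau ϖ X with hτdef
  have hX1 : 1 < X := lt_of_lt_of_le (by norm_num) hX15
  have hX0 : 0 < X := by linarith
  have hXe : Real.exp 1 ≤ X := by
    have : Real.exp 1 ≤ (2 : ℝ) ^ 15 := by have := Real.exp_one_lt_d9; norm_num; linarith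
    exact this.trans hX15
  set L := Real.log X with hL
  have hL10 : 10 ≤ L := ten_le_log hX15
  have hL1 : 1 ≤ L := by linarith
  have hη0 : 0 < η := lt_of_lt_of_le (Real.exp_pos _) hη
  obtain ⟨-, hXτ4, hCN⟩ := rpow_tau_bounds hX1 hτL
  -- members of `𝒜^(K)`
  have hE : ∀ xy ∈ boxPairs X η, pairIdeal xy ≠ ⊥ ∧ X ^ 3 < (Ideal.absNorm (pairIdeal xy) : ℝ) ∧
      (Ideal.absNorm (pairIdeal xy) : ℝ) ≤ 24 * X ^ 3 := fun xy hxy =>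
    ⟨pairIdeal_ne_bot_of_mem_boxPairs hX0.le xy hxy, absNorm_pairIdeal_bounds hX0 hη1 hxy⟩
  -- Lemma 7.1 for `𝒜`
  have h7A : ∀ (N z : ℝ) (𝒬 : Finset ℕ), X ^ τ ≤ z → 0 < N → N ≤ X ^ (2 - 2 * τ) →
      (∀ q ∈ 𝒬, Squarefree q ∧ N < q ∧ (q : ℝ) ≤ 2 * N) →
      ∑ Q ∈ normIn 𝒬, (famSifted (boxPairs X η) pairIdeal Q z : ℝ) ≤
        C₇' * (η ^ 2 * X ^ 2 / Real.log (min z (X ^ (2 - τ) / N)) *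
          ∑ Q ∈ normIn 𝒬, ((Ideal.absNorm Q : ℕ) : ℝ)⁻¹ + X ^ (2 - τ / 5)) := by
    intro N z 𝒬 hz hN hNX h𝒬
    have h := (h7 X η hX7 hη hη1 N z 𝒬 hz hN hNX h𝒬).1
    simp_rw [siftedA_eq_famSifted] at h
    refine h.trans (mul_le_mul_of_nonneg_right hCC ?_)
    have hlogmin : 0 ≤ Real.log (min z (X ^ (2 - τ) / N)) := by
      refine Real.log_nonneg ?_
      have hz1 : 1 ≤ z := le_trans (Real.one_le_rpow hX1.le hτ0.le) hz
      have h2 : 1 ≤ X ^ (2 - τ) / N := by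
        rw [le_div_iff₀ hN, one_mul]
        exact hNX.trans (Real.rpow_le_rpow_of_exponent_le hX1.le (by linarith))
      exact le_min hz1 h2
    have : 0 ≤ ∑ Q ∈ normIn 𝒬, ((Ideal.absNorm Q : ℕ) : ℝ)⁻¹ := sum_nonneg fun _ _ => by positivity
    positivity
  have hmain := U2_bound_of_h7 (boxPairs X η) pairIdeal hC₁ hwin hX15 hτ0 hτ40 hXτ4 hLτ hC₁τ
    (by norm_num : (1 : ℝ) ≤ 24) hCN hE hC₇'0 (by positivity) (by positivity) h7A
  -- the raw terms vanish or are small for `𝒜`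
  have hT1 : ∑ t ∈ (Upairs X τ 1).filter (fun t => ¬ UGood t),
      (famCount (boxPairs X η) pairIdeal (uIdeal t) : ℝ) = 0 := E1_A_eq_zero X η τ 1
  have hEq : ∑ x ∈ (primesNormIco (X ^ (1 / 2 : ℝ)) (24 * X ^ 3 + 1) ×ˢ
      primesNormIco (X ^ (1 / 2 : ℝ)) (24 * X ^ 3 + 1)).filter
      (fun x => x.1 ≠ x.2 ∧ Ideal.absNorm x.1 = Ideal.absNorm x.2),
      (famCount (boxPairs X η) pairIdeal (x.1 * x.2) : ℝ) = 0 := by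
    refine sum_eq_zero fun x hx => ?_
    rw [mem_filter, mem_product, mem_primesNormIco_iff, mem_primesNormIco_iff] at hx
    obtain ⟨⟨⟨h1, h10, -⟩, ⟨h2, -, -⟩⟩, hne, hN⟩ := hx
    rw [famCount_boxPairs, countA_eq_zero_of_absNorm_eq h1 h10 h2 hne hN (dvd_mul_right _ _) (dvd_mul_left _ _),
      Nat.cast_zero]
  have hDeg : ∑ Q ∈ (primesNormIco (X ^ (1 / 2 : ℝ)) (24 * X ^ 3 + 1)).filter
      (fun Q => ¬ (Ideal.absNorm Q).Prime), (famCount (boxPairs X η) pairIdeal Q : ℝ) = 0 := by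
    refine sum_eq_zero fun Q hQ => ?_
    rw [mem_filter, mem_primesNormIco_iff] at hQ
    rw [famCount_boxPairs, countA_eq_zero_of_not_prime hQ.1.1 hQ.1.2.1 (dvd_refl Q) hQ.2, Nat.cast_zero]
  have hSq := (sqDefect_A_le hX15 hη0 hτ0 (by linarith) (X := X) (τ := τ)).trans
    (sqDefect_A_absorb hX1 hτ0 (by linarith) hη1 (one_le_eta_mul hXe hη) hL1 (by
      have hη2 : Real.exp (-2 * Real.log X ^ (1 / 3 : ℝ)) ≤ η ^ 2 := by
        have : Real.exp (-2 * Real.log X ^ (1 / 3 : ℝ)) = Real.exp (-Real.log X ^ (1 / 3 : ℝ)) ^ 2 := by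
          rw [← Real.exp_nat_mul]; ring_nf
        rw [this]
        exact pow_le_pow_left₀ (Real.exp_pos _).le hη 2
      refine habs.trans ?_
      exact div_le_div_of_nonneg_right (mul_le_mul_of_nonneg_left hη2 hτ0.le) (by linarith)))
  rw [hT1, hEq, hDeg, zero_add, zero_add, zero_add, ← hL] at hmain
  -- absorb the error term
  have hη2 : Real.exp (-2 * Real.log X ^ (1 / 3 : ℝ)) ≤ η ^ 2 := by
    have : Real.exp (-2 * Real.log X ^ (1 / 3 : ℝ)) = Real.exp (-Real.log X ^ (1 / 3 : ℝ)) ^ 2 := by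
      rw [← Real.exp_nat_mul]; ring_nf
    rw [this]
    exact pow_le_pow_left₀ (Real.exp_pos _).le hη 2
  have habs' : X ^ (-τ / 5) * L ^ 3 ≤ τ * η ^ 2 / L := by
    refine habs.trans ?_
    exact div_le_div_of_nonneg_right (mul_le_mul_of_nonneg_left hη2 hτ0.le) (by linarith)
  have herr : 225 * L * (C₇' * X ^ (2 - τ / 5)) ≤ 225 * C₇' * (τ * η ^ 2 * X ^ 2 / L) := by
    have h := absorb_le (T := 225 * C₇') (δ := τ / 5) (j := 1) hX1.le hL1 (by positivity)
      le_rfl (by norm_num) habs'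
    have e : X ^ (2 - τ / 5) = X ^ 2 * X ^ (-(τ / 5)) := rpow_two_sub hX0 (τ / 5)
    rw [pow_one] at h
    calc 225 * L * (C₇' * X ^ (2 - τ / 5)) = 225 * C₇' * (X ^ 2 * X ^ (-(τ / 5)) * L) := by rw [e]; ring
      _ ≤ _ := h
  have hscale : hbXi τ / τ ^ 4 = τ := hbXi_div_pow_four hτ0.ne'
  rw [hscale]
  have hK0 : 0 ≤ 600 + 400 * C₁ + 8 * Real.log (2 * 24) := by
    have : 0 ≤ Real.log (2 * 24) := Real.log_nonneg (by norm_num)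
    positivity
  have hfinal : 72 * (180 * (τ * η ^ 2 * X ^ 2 / L)) +
      C₇' * (600 + 400 * C₁ + 8 * Real.log (2 * 24)) * (τ * (η ^ 2 * X ^ 2) / L) +
      225 * C₇' * (τ * η ^ 2 * X ^ 2 / L) =
      (C₇' * (600 + 400 * C₁ + 8 * Real.log (2 * 24) + 225) + 72 * 180) * τ * (η ^ 2 * X ^ 2 / L) := by ring
  calc _ ≤ 72 * ∑ Q ∈ (primesNormIco (X ^ (1 / 2 : ℝ)) (X ^ (1 - τ))).filter
          (fun Q => (Ideal.absNorm Q).Prime), (famCount (boxPairs X η) pairIdeal (Q * Q) : ℝ) +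
        C₇' * (600 + 400 * C₁ + 8 * Real.log (2 * 24)) * (τ * (η ^ 2 * X ^ 2) / L) +
        225 * L * (C₇' * X ^ (2 - τ / 5)) := hmain
    _ ≤ 72 * (180 * (τ * η ^ 2 * X ^ 2 / L)) +
        C₇' * (600 + 400 * C₁ + 8 * Real.log (2 * 24)) * (τ * (η ^ 2 * X ^ 2) / L) +
        225 * C₇' * (τ * η ^ 2 * X ^ 2 / L) :=
        add_le_add (add_le_add (mul_le_mul_of_nonneg_left hSq (by norm_num)) le_rfl) herr
    _ = _ := hfinal

/-- `32 ≤ X^{1/2}` for `X ≥ 2^{15}`. [folklore] -/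
theorem thirtytwo_le_sqrt (hX : (2 : ℝ) ^ 15 ≤ X) : (32 : ℝ) ≤ X ^ (1 / 2 : ℝ) := by
  have h1 : ((2 : ℝ) ^ 15) ^ (1 / 2 : ℝ) ≤ X ^ (1 / 2 : ℝ) :=
    Real.rpow_le_rpow (by norm_num) hX (by norm_num)
  have h2 : (32 : ℝ) ≤ ((2 : ℝ) ^ 15) ^ (1 / 2 : ℝ) := by
    rw [show ((2 : ℝ) ^ 15) = (2 ^ (15 : ℝ)) by norm_num, ← Real.rpow_mul (by norm_num)]
    have : (32 : ℝ) = 2 ^ (5 : ℝ) := by norm_num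
    rw [this]
    exact Real.rpow_le_rpow_of_exponent_le (by norm_num) (by norm_num)
  exact h2.trans h1

open scoped Classical in
/-- **The non-good pairs for `ℬ^(K)`** ((7.7) with `n = 1`): at most
`C_ℬ(72 X³X^{−τ/3} log X + 36 X³X^{−τ})` (primes of degree `≥ 2` in `𝒫₀`, `≪ X^{−τ/3}`, times
`∑_{𝒫₀} N(P)^{-1} ≤ 3(1 + log X)`; pairs of equal norm, `≪ X^{−τ}`). [cite: HeathBrownActa2001, §7 (7.7)] -/
theorem rawB_nonGood_le (hX15 : (2 : ℝ) ^ 15 ≤ X) (hτ0 : 0 < τ) (hτ1 : τ ≤ 1 / 2) (hXτ16 : 16 ≤ X ^ τ)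
    {C_B : ℝ} (hCB : 0 ≤ C_B)
    (hcount : ∀ R : Ideal (𝓞 K), R ≠ ⊥ → (countB X η R : ℝ) ≤ C_B * X ^ 3 / Ideal.absNorm R) :
    ∑ t ∈ (Upairs X τ 1).filter (fun t => ¬ UGood t), (famCount (normWindow X η) (fun J => J) (uIdeal t) : ℝ) ≤
      C_B * (72 * (X ^ 3 * X ^ (-(τ / 3)) * Real.log X ^ 1) + 36 * (X ^ 3 * X ^ (-τ) * Real.log X ^ 0)) := by
  classical
  have hX1 : 1 < X := lt_of_lt_of_le (by norm_num) hX15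
  have hX0 : 0 < X := by linarith
  set L := Real.log X with hL
  have hL10 : 10 ≤ L := ten_le_log hX15
  have hsP : ∀ P ∈ smallPrimes X τ, P.IsPrime ∧ P ≠ ⊥ ∧ X ^ τ ≤ (Ideal.absNorm P : ℝ) ∧
      (Ideal.absNorm P : ℝ) < X ^ (1 - τ) := fun P hP => mem_smallPrimes_iff.mp hP
  have hY8 : (8 : ℝ) ≤ X ^ τ / 2 := by linarith
  have hW₁ := sum_inv_absNorm_nonprime_le hY8 ((smallPrimes X τ).filter (fun P => ¬ (Ideal.absNorm P).Prime))
    (fun P hP => by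
      rw [mem_filter] at hP
      obtain ⟨h1, h2, h3, -⟩ := hsP P hP.1
      exact ⟨h1, h2, hP.2, by linarith⟩)
  have hW₂ := sum_inv_absNorm_pair_eq_le (show (2 : ℝ) ≤ X ^ τ / 2 by linarith)
    ((smallPrimes X τ ×ˢ smallPrimes X τ).filter (fun x => x.1 ≠ x.2 ∧ Ideal.absNorm x.1 = Ideal.absNorm x.2))
    (fun x hx => by
      rw [mem_filter, mem_product] at hx
      obtain ⟨⟨h1, h2⟩, -, hN⟩ := hx
      obtain ⟨a1, a2, a3, -⟩ := hsP x.1 h1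
      obtain ⟨b1, b2, -, -⟩ := hsP x.2 h2
      exact ⟨a1, a2, b1, b2, hN, by linarith⟩)
  have h := E1_B_le (X := X) (η := η) (τ := τ) (n := 1) hX0.le hCB hcount hW₁ hW₂ le_rfl
  refine h.trans ?_
  have hw0 : ∀ P ∈ smallPrimes X τ, 0 ≤ ((Ideal.absNorm P : ℕ) : ℝ)⁻¹ := fun _ _ => by positivity
  have he1 : ∑ s ∈ (smallPrimes X τ).powersetCard 1, ∏ P ∈ s, ((Ideal.absNorm P : ℕ) : ℝ)⁻¹ ≤ 3 * (1 + L) := by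
    have h1 := esymm_le_pow_div_factorial (smallPrimes X τ) (fun P => ((Ideal.absNorm P : ℕ) : ℝ)⁻¹) hw0 1
    rw [pow_one, Nat.factorial_one, Nat.cast_one, div_one] at h1
    refine h1.trans ?_
    have h2 := sum_inv_absNorm_le (x := X ^ (1 - τ)) (Real.one_le_rpow hX1.le (by linarith)) (smallPrimes X τ)
      (fun P hP => ⟨(hsP P hP).1, (hsP P hP).2.1, (hsP P hP).2.2.2.le⟩)
    refine h2.trans ?_
    have : Real.log (X ^ (1 - τ)) ≤ L := by
      rw [Real.log_rpow hX0]; nlinarith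
    linarith
  have he0 : ∑ s ∈ (smallPrimes X τ).powersetCard (1 - 1), ∏ P ∈ s, ((Ideal.absNorm P : ℕ) : ℝ)⁻¹ ≤ 1 := by
    have h1 := esymm_le_pow_div_factorial (smallPrimes X τ) (fun P => ((Ideal.absNorm P : ℕ) : ℝ)⁻¹) hw0 0
    rw [pow_zero, Nat.factorial_zero, Nat.cast_one, div_one] at h1
    exact h1
  have hXτ0 : 0 < X ^ τ := Real.rpow_pos_of_pos hX0 _
  have hW₁b : 6 / (X ^ τ / 2) ^ (1 / 3 : ℝ) ≤ 12 * X ^ (-(τ / 3)) := by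
    have h1 : (X ^ τ / 8) ^ (1 / 3 : ℝ) ≤ (X ^ τ / 2) ^ (1 / 3 : ℝ) :=
      Real.rpow_le_rpow (by positivity) (by linarith) (by norm_num)
    have h2 : (X ^ τ / 8) ^ (1 / 3 : ℝ) = X ^ (τ / 3) / 2 := by
      rw [Real.div_rpow hXτ0.le (by norm_num), ← Real.rpow_mul hX0.le,
        show (8 : ℝ) = 2 ^ (3 : ℝ) by norm_num, ← Real.rpow_mul (by norm_num), mul_one_div]
      norm_num
    have h3 : 0 < X ^ (τ / 3) / 2 := by positivity
    calc 6 / (X ^ τ / 2) ^ (1 / 3 : ℝ) ≤ 6 / (X ^ (τ / 3) / 2) := by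
          rw [← h2]; exact div_le_div_of_nonneg_left (by norm_num) (by rw [h2]; exact h3) h1
      _ = 12 * (X ^ (τ / 3))⁻¹ := by field_simp; ring
      _ = 12 * X ^ (-(τ / 3)) := by rw [Real.rpow_neg hX0.le]
  have hW₂b : 18 / (X ^ τ / 2) = 36 * X ^ (-τ) := by
    rw [Real.rpow_neg hX0.le]; field_simp; ring
  have hA : 6 / (X ^ τ / 2) ^ (1 / 3 : ℝ) * ∑ s ∈ (smallPrimes X τ).powersetCard 1, ∏ P ∈ s, ((Ideal.absNorm P : ℕ) : ℝ)⁻¹ ≤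
      12 * X ^ (-(τ / 3)) * (3 * (1 + L)) :=
    mul_le_mul hW₁b he1 (esymm_nonneg _ _ hw0 1) (by positivity)
  have hB : 18 / (X ^ τ / 2) * ∑ s ∈ (smallPrimes X τ).powersetCard (1 - 1), ∏ P ∈ s, ((Ideal.absNorm P : ℕ) : ℝ)⁻¹ ≤
      36 * X ^ (-τ) * 1 := by
    rw [hW₂b]; exact mul_le_mul_of_nonneg_left he0 (by positivity)
  have h1L : 1 + L ≤ 2 * L := by linarith
  have hx3 : 0 ≤ X ^ (-(τ / 3)) := Real.rpow_nonneg hX0.le _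
  calc C_B * X ^ 3 * (6 / (X ^ τ / 2) ^ (1 / 3 : ℝ) *
          ∑ s ∈ (smallPrimes X τ).powersetCard 1, ∏ P ∈ s, ((Ideal.absNorm P : ℕ) : ℝ)⁻¹ +
        18 / (X ^ τ / 2) * ∑ s ∈ (smallPrimes X τ).powersetCard (1 - 1), ∏ P ∈ s, ((Ideal.absNorm P : ℕ) : ℝ)⁻¹)
      ≤ C_B * X ^ 3 * (12 * X ^ (-(τ / 3)) * (3 * (1 + L)) + 36 * X ^ (-τ) * 1) :=
        mul_le_mul_of_nonneg_left (add_le_add hA hB) (by positivity)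
    _ ≤ C_B * X ^ 3 * (12 * X ^ (-(τ / 3)) * (3 * (2 * L)) + 36 * X ^ (-τ) * 1) := by gcongr
    _ = C_B * (72 * (X ^ 3 * X ^ (-(τ / 3)) * L ^ 1) + 36 * (X ^ 3 * X ^ (-τ) * L ^ 0)) := by ring

open scoped Classical in
/-- **The equal-norm pairs for `ℬ^(K)`** ((7.7)): `∑ #ℬ^(K)_{QQ'} ≤ 36 C_ℬ X³X^{−1/2}`.
[cite: HeathBrownActa2001, §7 (7.7)] -/
theorem rawB_eqNorm_le (hX15 : (2 : ℝ) ^ 15 ≤ X) {B C_B : ℝ} (hCB : 0 ≤ C_B)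
    (hcount : ∀ R : Ideal (𝓞 K), R ≠ ⊥ → (countB X η R : ℝ) ≤ C_B * X ^ 3 / Ideal.absNorm R) :
    ∑ x ∈ (primesNormIco (X ^ (1 / 2 : ℝ)) B ×ˢ primesNormIco (X ^ (1 / 2 : ℝ)) B).filter
        (fun x => x.1 ≠ x.2 ∧ Ideal.absNorm x.1 = Ideal.absNorm x.2),
        (famCount (normWindow X η) (fun J => J) (x.1 * x.2) : ℝ) ≤ 36 * C_B * (X ^ 3 * X ^ (-(1 / 2 : ℝ))) := by
  classical
  have hX1 : 1 < X := lt_of_lt_of_le (by norm_num) hX15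
  have hX0 : 0 < X := by linarith
  have h32 := thirtytwo_le_sqrt hX15
  set D := (primesNormIco (X ^ (1 / 2 : ℝ)) B ×ˢ primesNormIco (X ^ (1 / 2 : ℝ)) B).filter
    (fun x => x.1 ≠ x.2 ∧ Ideal.absNorm x.1 = Ideal.absNorm x.2) with hD
  have hDmem : ∀ x ∈ D, x.1.IsPrime ∧ x.1 ≠ ⊥ ∧ x.2.IsPrime ∧ x.2 ≠ ⊥ ∧
      Ideal.absNorm x.1 = Ideal.absNorm x.2 ∧ X ^ (1 / 2 : ℝ) / 2 < (Ideal.absNorm x.1 : ℝ) := by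
    intro x hx
    rw [hD, mem_filter, mem_product, mem_primesNormIco_iff, mem_primesNormIco_iff] at hx
    obtain ⟨⟨⟨h1, h10, h1lo, -⟩, ⟨h2, h20, -, -⟩⟩, -, hN⟩ := hx
    exact ⟨h1, h10, h2, h20, hN, by linarith⟩
  have h := sum_inv_absNorm_pair_eq_le (show (2 : ℝ) ≤ X ^ (1 / 2 : ℝ) / 2 by linarith) D hDmem
  have step1 : ∑ x ∈ D, (famCount (normWindow X η) (fun J => J) (x.1 * x.2) : ℝ) ≤
      C_B * X ^ 3 * ∑ x ∈ D, ((Ideal.absNorm x.1 : ℕ) : ℝ)⁻¹ * ((Ideal.absNorm x.2 : ℕ) : ℝ)⁻¹ := by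
    rw [mul_sum]
    refine sum_le_sum fun x hx => ?_
    obtain ⟨h1, h10, h2, h20, -⟩ := hDmem x hx
    have hR : x.1 * x.2 ≠ ⊥ := mul_ne_zero h10 h20
    rw [famCount_normWindow]
    refine (hcount _ hR).trans (le_of_eq ?_)
    rw [map_mul, Nat.cast_mul]; field_simp
  refine step1.trans ?_
  calc C_B * X ^ 3 * ∑ x ∈ D, ((Ideal.absNorm x.1 : ℕ) : ℝ)⁻¹ * ((Ideal.absNorm x.2 : ℕ) : ℝ)⁻¹ ≤
      C_B * X ^ 3 * (18 / (X ^ (1 / 2 : ℝ) / 2)) := mul_le_mul_of_nonneg_left h (by positivity)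
    _ = 36 * C_B * (X ^ 3 * X ^ (-(1 / 2 : ℝ))) := by
        rw [Real.rpow_neg hX0.le]; field_simp; ring

open scoped Classical in
/-- **The primes of degree `≥ 2` for `ℬ^(K)`** ((7.7)): `∑ #ℬ^(K)_Q ≤ 12 C_ℬ X³X^{−1/6}`.
[cite: HeathBrownActa2001, §7 (7.7)] -/
theorem rawB_degTwo_le (hX15 : (2 : ℝ) ^ 15 ≤ X) {B C_B : ℝ} (hCB : 0 ≤ C_B)
    (hcount : ∀ R : Ideal (𝓞 K), R ≠ ⊥ → (countB X η R : ℝ) ≤ C_B * X ^ 3 / Ideal.absNorm R) :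
    ∑ Q ∈ (primesNormIco (X ^ (1 / 2 : ℝ)) B).filter (fun Q => ¬ (Ideal.absNorm Q).Prime),
        (famCount (normWindow X η) (fun J => J) Q : ℝ) ≤ 12 * C_B * (X ^ 3 * X ^ (-(1 / 6 : ℝ))) := by
  classical
  have hX1 : 1 < X := lt_of_lt_of_le (by norm_num) hX15
  have hX0 : 0 < X := by linarith
  have h32 := thirtytwo_le_sqrt hX15
  set S := (primesNormIco (X ^ (1 / 2 : ℝ)) B).filter (fun Q => ¬ (Ideal.absNorm Q).Prime) with hS
  have hSmem : ∀ P ∈ S, P.IsPrime ∧ P ≠ ⊥ ∧ ¬ (Ideal.absNorm P).Prime ∧ X ^ (1 / 2 : ℝ) / 2 < (Ideal.absNorm P : ℝ) := by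
    intro P hP
    rw [hS, mem_filter, mem_primesNormIco_iff] at hP
    refine ⟨hP.1.1, hP.1.2.1, hP.2, ?_⟩
    linarith [hP.1.2.2.1]
  have hY : (8 : ℝ) ≤ X ^ (1 / 2 : ℝ) / 2 := by linarith
  have hrec := sum_inv_absNorm_nonprime_le hY S hSmem
  have step1 : ∑ P ∈ S, (famCount (normWindow X η) (fun J => J) P : ℝ) ≤
      C_B * X ^ 3 * ∑ P ∈ S, ((Ideal.absNorm P : ℕ) : ℝ)⁻¹ := by
    rw [mul_sum]
    refine sum_le_sum fun P hP => ?_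
    have h := hcount P (hSmem P hP).2.1
    rw [div_eq_mul_inv] at h
    rw [famCount_normWindow]; exact h
  have hXh0 : 0 < X ^ (1 / 2 : ℝ) := by positivity
  have step2 : 6 / (X ^ (1 / 2 : ℝ) / 2) ^ (1 / 3 : ℝ) ≤ 12 * X ^ (-(1 / 6 : ℝ)) := by
    have h1 : (X ^ (1 / 2 : ℝ) / 8) ^ (1 / 3 : ℝ) ≤ (X ^ (1 / 2 : ℝ) / 2) ^ (1 / 3 : ℝ) :=
      Real.rpow_le_rpow (by positivity) (by linarith) (by norm_num)
    have h2 : (X ^ (1 / 2 : ℝ) / 8) ^ (1 / 3 : ℝ) = X ^ (1 / 6 : ℝ) / 2 := by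
      rw [Real.div_rpow hXh0.le (by norm_num), ← Real.rpow_mul hX0.le,
        show (8 : ℝ) = 2 ^ (3 : ℝ) by norm_num, ← Real.rpow_mul (by norm_num)]
      norm_num
    have h3 : 0 < X ^ (1 / 6 : ℝ) / 2 := by positivity
    calc 6 / (X ^ (1 / 2 : ℝ) / 2) ^ (1 / 3 : ℝ) ≤ 6 / (X ^ (1 / 6 : ℝ) / 2) := by
          rw [← h2]; exact div_le_div_of_nonneg_left (by norm_num) (by rw [h2]; exact h3) h1
      _ = 12 * (X ^ (1 / 6 : ℝ))⁻¹ := by field_simp; ring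
      _ = 12 * X ^ (-(1 / 6 : ℝ)) := by rw [Real.rpow_neg hX0.le]
  calc ∑ P ∈ S, (famCount (normWindow X η) (fun J => J) P : ℝ) ≤
      C_B * X ^ 3 * ∑ P ∈ S, ((Ideal.absNorm P : ℕ) : ℝ)⁻¹ := step1
    _ ≤ C_B * X ^ 3 * (12 * X ^ (-(1 / 6 : ℝ))) := mul_le_mul_of_nonneg_left (hrec.trans step2) (by positivity)
    _ = 12 * C_B * (X ^ 3 * X ^ (-(1 / 6 : ℝ))) := by ring

open scoped Classical in
/-- **The square defect for `ℬ^(K)`** ((7.7)): `∑_Q #ℬ^(K)_{Q²} ≤ 12 C_ℬ X³X^{−1/2}` over first-degree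
`Q` with `N(Q) ≥ X^{1/2}`. [cite: HeathBrownActa2001, §7 (7.7)] -/
theorem rawB_sq_le (hX15 : (2 : ℝ) ^ 15 ≤ X) {B C_B : ℝ} (hCB : 0 ≤ C_B)
    (hcount : ∀ R : Ideal (𝓞 K), R ≠ ⊥ → (countB X η R : ℝ) ≤ C_B * X ^ 3 / Ideal.absNorm R) :
    ∑ Q ∈ (primesNormIco (X ^ (1 / 2 : ℝ)) B).filter (fun Q => (Ideal.absNorm Q).Prime),
        (famCount (normWindow X η) (fun J => J) (Q * Q) : ℝ) ≤ 12 * C_B * (X ^ 3 * X ^ (-(1 / 2 : ℝ))) := by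
  classical
  have hX1 : 1 < X := lt_of_lt_of_le (by norm_num) hX15
  have hX0 : 0 < X := by linarith
  have h32 := thirtytwo_le_sqrt hX15
  set S := (primesNormIco (X ^ (1 / 2 : ℝ)) B).filter (fun Q => (Ideal.absNorm Q).Prime) with hS
  have hSmem : ∀ Q ∈ S, Q.IsPrime ∧ Q ≠ ⊥ ∧ X ^ (1 / 2 : ℝ) ≤ (Ideal.absNorm Q : ℝ) := by
    intro Q hQ
    rw [hS, mem_filter, mem_primesNormIco_iff] at hQ
    exact ⟨hQ.1.1, hQ.1.2.1, hQ.1.2.2.1⟩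
  have step1 : ∑ Q ∈ S, (famCount (normWindow X η) (fun J => J) (Q * Q) : ℝ) ≤
      C_B * X ^ 3 * ∑ Q ∈ S, (((Ideal.absNorm Q : ℕ) : ℝ) ^ 2)⁻¹ := by
    rw [mul_sum]
    refine sum_le_sum fun Q hQ => ?_
    obtain ⟨-, h0, -⟩ := hSmem Q hQ
    rw [famCount_normWindow]
    refine (hcount _ (mul_ne_zero h0 h0)).trans (le_of_eq ?_)
    rw [map_mul, Nat.cast_mul, sq, div_eq_mul_inv]
  have step2 : ∑ Q ∈ S, (((Ideal.absNorm Q : ℕ) : ℝ) ^ 2)⁻¹ ≤ 3 * ∑ q ∈ S.image Ideal.absNorm, ((q : ℝ) ^ 2)⁻¹ :=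
    sum_primes_le_three_mul_sum_image S (fun Q hQ => ⟨(hSmem Q hQ).1, (hSmem Q hQ).2.1⟩)
      (g := fun q : ℕ => ((q : ℝ) ^ 2)⁻¹) (fun q => by positivity)
  have step3 : ∑ q ∈ S.image Ideal.absNorm, ((q : ℝ) ^ 2)⁻¹ ≤ 2 / (X ^ (1 / 2 : ℝ) / 2) :=
    sum_inv_sq_tail_le (show (2 : ℝ) ≤ X ^ (1 / 2 : ℝ) / 2 by linarith) _ (fun q hq => by
      obtain ⟨Q, hQ, rfl⟩ := mem_image.mp hq
      have := (hSmem Q hQ).2.2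
      linarith)
  calc ∑ Q ∈ S, (famCount (normWindow X η) (fun J => J) (Q * Q) : ℝ) ≤
      C_B * X ^ 3 * ∑ Q ∈ S, (((Ideal.absNorm Q : ℕ) : ℝ) ^ 2)⁻¹ := step1
    _ ≤ C_B * X ^ 3 * (3 * (2 / (X ^ (1 / 2 : ℝ) / 2))) :=
        mul_le_mul_of_nonneg_left (step2.trans (mul_le_mul_of_nonneg_left step3 (by norm_num))) (by positivity)
    _ = 12 * C_B * (X ^ 3 * X ^ (-(1 / 2 : ℝ))) := by
        rw [Real.rpow_neg hX0.le]; field_simp; ring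

open scoped Classical in
/-- **Lemma 3.7 for `U₂^{(1)}(ℬ)` from the corrected Lemma 7.1**:
`|U₂^{(1)}(ℬ) − Û₂^{(1)}(ℬ)| ≤ C ξτ^{-4} ηX³/log X` for `X ≥ X₀`, `η` in (2.1). For `ℬ^(K)` the raw
terms are handled by the crude count (7.7), `#ℬ^(K)_R ≤ C_ℬ X³/N(R)`: the non-good pairs
`≪ X³(X^{−τ/3} log X + X^{−τ})`, the equal-norm pairs and squares `≪ X³X^{−1/2}`, the primes of
degree `≥ 2` `≪ X³X^{−1/6}`. [cite: HeathBrownActa2001, Lemma 3.7] -/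
theorem U2_B_bound (h71 : HeathBrown2001_lemma_7_1_normWeighted) {ϖ : ℝ} (hϖ0 : 0 < ϖ)
    (hϖ1 : ϖ < 1 / 5) :
    ∃ C X₀ : ℝ, ∀ X η : ℝ, X₀ ≤ X → Real.exp (-Real.log X ^ (1 / 3 : ℝ)) ≤ η → η ≤ 1 →
      |(U2one (normWindow X η) (fun J => J) X (hbTau ϖ X) : ℝ) -
          U2hat X (hbTau ϖ X) (normWindow X η) (fun J => J)| ≤
        C * (hbXi (hbTau ϖ X) / hbTau ϖ X ^ 4) * (η * X ^ 3 / Real.log X) := by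
  classical
  obtain ⟨C₇, X₇, h7⟩ := h71 ϖ hϖ0 hϖ1
  obtain ⟨C₁, hC₁, hwin⟩ := exists_sum_normWt_window_le
  obtain ⟨C_B, hCB, hcountB⟩ := exists_countB_le
  have hϖ1' : ϖ ≤ 1 := by linarith
  set C₇' : ℝ := max C₇ 1 with hC₇'
  have hC₇'0 : 0 ≤ C₇' := le_trans zero_le_one (le_max_right _ _)
  have hCC : C₇ ≤ C₇' := le_max_left _ _
  obtain ⟨X₁, hX₁⟩ := Filter.eventually_atTop.mp (eventually_U2_params hϖ0 hϖ1' hC₁ X₇)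
  refine ⟨C₇' * (600 + 400 * C₁ + 8 * Real.log (2 * 6) + 225) + C_B * (108 + 72 * 60), X₁,
    fun X η hX hη hη1 => ?_⟩
  obtain ⟨hX7, hX15, hτ0, hτ40, hLτ, hC₁τ, hτL, habs⟩ := hX₁ X hX
  set τ := hbTau ϖ X with hτdef
  have hX1 : 1 < X := lt_of_lt_of_le (by norm_num) hX15
  have hX0 : 0 < X := by linarith
  set L := Real.log X with hL
  have hL10 : 10 ≤ L := ten_le_log hX15
  have hL1 : 1 ≤ L := by linarith
  have hη0 : 0 < η := lt_of_lt_of_le (Real.exp_pos _) hη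
  obtain ⟨hXτ16, hXτ4, hCN24⟩ := rpow_tau_bounds hX1 hτL
  have hCN : (6 : ℝ) < X ^ (3 * τ) := by linarith
  -- members of `ℬ^(K)`
  have hE : ∀ J ∈ normWindow X η, (fun J : Ideal (𝓞 K) => J) J ≠ ⊥ ∧
      X ^ 3 < (Ideal.absNorm ((fun J : Ideal (𝓞 K) => J) J) : ℝ) ∧
      (Ideal.absNorm ((fun J : Ideal (𝓞 K) => J) J) : ℝ) ≤ 6 * X ^ 3 := fun J hJ =>
    ⟨ne_bot_of_mem_normWindow hX0.le J hJ, absNorm_normWindow_bounds hX0 hη1 hJ⟩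
  -- Lemma 7.1 for `ℬ`
  have h7B : ∀ (N z : ℝ) (𝒬 : Finset ℕ), X ^ τ ≤ z → 0 < N → N ≤ X ^ (2 - 2 * τ) →
      (∀ q ∈ 𝒬, Squarefree q ∧ N < q ∧ (q : ℝ) ≤ 2 * N) →
      ∑ Q ∈ normIn 𝒬, (famSifted (normWindow X η) (fun J => J) Q z : ℝ) ≤
        C₇' * (η * X ^ 3 / Real.log (min z (X ^ (2 - τ) / N)) *
          ∑ Q ∈ normIn 𝒬, ((Ideal.absNorm Q : ℕ) : ℝ)⁻¹ + X ^ (3 - τ / 5)) := by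
    intro N z 𝒬 hz hN hNX h𝒬
    have h := (h7 X η hX7 hη hη1 N z 𝒬 hz hN hNX h𝒬).2
    simp_rw [siftedB_eq_famSifted] at h
    refine h.trans (mul_le_mul_of_nonneg_right hCC ?_)
    have hlogmin : 0 ≤ Real.log (min z (X ^ (2 - τ) / N)) := by
      refine Real.log_nonneg ?_
      have hz1 : 1 ≤ z := le_trans (Real.one_le_rpow hX1.le hτ0.le) hz
      have h2 : 1 ≤ X ^ (2 - τ) / N := by
        rw [le_div_iff₀ hN, one_mul]
        exact hNX.trans (Real.rpow_le_rpow_of_exponent_le hX1.le (by linarith))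
      exact le_min hz1 h2
    have : 0 ≤ ∑ Q ∈ normIn 𝒬, ((Ideal.absNorm Q : ℕ) : ℝ)⁻¹ := sum_nonneg fun _ _ => by positivity
    positivity
  have hmain := U2_bound_of_h7 (normWindow X η) (fun J => J) hC₁ hwin hX15 hτ0 hτ40 hXτ4 hLτ hC₁τ
    (by norm_num : (1 : ℝ) ≤ 6) hCN hE hC₇'0 (by positivity) (by positivity) h7B
  have hcount : ∀ R : Ideal (𝓞 K), R ≠ ⊥ → (countB X η R : ℝ) ≤ C_B * X ^ 3 / Ideal.absNorm R :=
    fun R hR => hcountB X η hX0.le hη0.le hη1 R hR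
  have hT1 := rawB_nonGood_le (η := η) hX15 hτ0 (by linarith) hXτ16 hCB.le hcount
  have hEq := rawB_eqNorm_le (η := η) (B := 6 * X ^ 3 + 1) hX15 hCB.le hcount
  have hDeg := rawB_degTwo_le (η := η) (B := 6 * X ^ 3 + 1) hX15 hCB.le hcount
  have hSq := rawB_sq_le (η := η) (B := X ^ (1 - τ)) hX15 hCB.le hcount
  -- absorption
  have hη2 : Real.exp (-2 * Real.log X ^ (1 / 3 : ℝ)) ≤ η ^ 2 := by
    have : Real.exp (-2 * Real.log X ^ (1 / 3 : ℝ)) = Real.exp (-Real.log X ^ (1 / 3 : ℝ)) ^ 2 := by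
      rw [← Real.exp_nat_mul]; ring_nf
    rw [this]
    exact pow_le_pow_left₀ (Real.exp_pos _).le hη 2
  have habs' : X ^ (-τ / 5) * L ^ 3 ≤ τ * η ^ 2 / L := by
    refine habs.trans ?_
    exact div_le_div_of_nonneg_right (mul_le_mul_of_nonneg_left hη2 hτ0.le) (by linarith)
  have a1 : C_B * (72 * (X ^ 3 * X ^ (-(τ / 3)) * L ^ 1)) ≤ C_B * (72 * (τ * η * X ^ 3 / L)) :=
    mul_le_mul_of_nonneg_left (absorb_le3 (T := 72) (δ := τ / 3) (j := 1) hX1.le hL1 (by norm_num) hη0.le hη1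
      hτ0.le (by linarith) (by norm_num) habs') hCB.le
  have a2 : C_B * (36 * (X ^ 3 * X ^ (-τ) * L ^ 0)) ≤ C_B * (36 * (τ * η * X ^ 3 / L)) :=
    mul_le_mul_of_nonneg_left (absorb_le3 (T := 36) (δ := τ) (j := 0) hX1.le hL1 (by norm_num) hη0.le hη1
      hτ0.le (by linarith) (by norm_num) habs') hCB.le
  have a3 : 36 * C_B * (X ^ 3 * X ^ (-(1 / 2 : ℝ)) * L ^ 0) ≤ 36 * C_B * (τ * η * X ^ 3 / L) :=
    absorb_le3 (T := 36 * C_B) (δ := 1 / 2) (j := 0) hX1.le hL1 (by positivity) hη0.le hη1 hτ0.le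
      (by linarith) (by norm_num) habs'
  have a4 : 12 * C_B * (X ^ 3 * X ^ (-(1 / 6 : ℝ)) * L ^ 0) ≤ 12 * C_B * (τ * η * X ^ 3 / L) :=
    absorb_le3 (T := 12 * C_B) (δ := 1 / 6) (j := 0) hX1.le hL1 (by positivity) hη0.le hη1 hτ0.le
      (by linarith) (by norm_num) habs'
  have a5 : 12 * C_B * (X ^ 3 * X ^ (-(1 / 2 : ℝ)) * L ^ 0) ≤ 12 * C_B * (τ * η * X ^ 3 / L) :=
    absorb_le3 (T := 12 * C_B) (δ := 1 / 2) (j := 0) hX1.le hL1 (by positivity) hη0.le hη1 hτ0.le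
      (by linarith) (by norm_num) habs'
  have herr : 225 * L * (C₇' * X ^ (3 - τ / 5)) ≤ 225 * C₇' * (τ * η * X ^ 3 / L) := by
    have h := absorb_le3 (T := 225 * C₇') (δ := τ / 5) (j := 1) hX1.le hL1 (by positivity) hη0.le hη1 hτ0.le
      le_rfl (by norm_num) habs'
    have e : X ^ (3 - τ / 5) = X ^ 3 * X ^ (-(τ / 5)) := rpow_three_sub hX0 (τ / 5)
    rw [pow_one] at h
    calc 225 * L * (C₇' * X ^ (3 - τ / 5)) = 225 * C₇' * (X ^ 3 * X ^ (-(τ / 5)) * L) := by rw [e]; ring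
      _ ≤ _ := h
  rw [pow_zero, mul_one] at a2 a3 a4 a5
  rw [pow_zero, mul_one, ← hL] at hT1
  rw [← hL] at hmain
  have hscale : hbXi τ / τ ^ 4 = τ := hbXi_div_pow_four hτ0.ne'
  rw [hscale]
  have hfinal : C_B * (72 * (τ * η * X ^ 3 / L)) + C_B * (36 * (τ * η * X ^ 3 / L)) +
      72 * (36 * C_B * (τ * η * X ^ 3 / L) + 12 * C_B * (τ * η * X ^ 3 / L) + 12 * C_B * (τ * η * X ^ 3 / L)) +
      C₇' * (600 + 400 * C₁ + 8 * Real.log (2 * 6)) * (τ * (η * X ^ 3) / L) +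
      225 * C₇' * (τ * η * X ^ 3 / L) =
      (C₇' * (600 + 400 * C₁ + 8 * Real.log (2 * 6) + 225) + C_B * (108 + 72 * 60)) * τ * (η * X ^ 3 / L) := by
    ring
  linarith [hmain, hT1, hEq, hDeg, hSq, a1, a2, a3, a4, a5, herr, hfinal]

end Final


end Literature.NumberTheory.Sieve.CubicSieve

end
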